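import Literature.MathematicalPhysics.QuantumFieldTheory.Balaban1983to89.B9Eq3132SectDLetters
import Literature.MathematicalPhysics.QuantumFieldTheory.Balaban1983to89.Node00.OpsYGauge

/-!
# `Balaban1983to89.Node00.OpsYSectDE` — T. Bałaban, *Propagators for lattice gauge theories in a background field*, Commun. Math. Phys. **99**
# (1985) 389–434 [Balaban1985BackgroundPropagators], Sect. D (3.117)–(3.153) pp. 419–427 and Thm 3.14: THE REMAINING SECT. D∕E LETTERS OF NODE 00's
# OPERATOR LAYER AS FUNCTIONS OF THE BACKGROUND, BUILT ON n06-i's `B9Eq3132SectDLetters` (`π`, `Δ_π` (3.119), `G_D` (3.122), `(QGQ*)⁻¹`, `H`) —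
# `Δ′_π` (3.120); `G₁`, `H₁ = G₁Q*(QG₁Q*)⁻¹`, `(QG₁Q*)⁻¹` (3.128)–(3.129), (3.132) over the residual letter `Δ⁽²⁾` of (3.134)–(3.135); `𝔓` (3.147),
# `𝔊 = 𝔓G₁` (3.153); Theorem 3.14's `G(Ω, U) − G(Ω′, U)`; the printed algebra (3.130), (3.135), (3.138), (3.153) KERNEL-CHECKED; `Δ_π(1) = Δ(1)` with NO
# hypothesis on the transporters, `G₁(1) = G(1) = Gop♯`; (3.33)–(3.34) GAUGE COVARIANCE of every Sect. D letter (`Δ_π`, `G_D`, `(QGQ*)⁻¹`, `H`, `G₁`, `H₁`,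
# `𝔊`, Thm 3.14's difference); def-Y's v3 family `covLettersY_v3 = withSectD ∘ withDE ∘ v2` and THE INSTANCE `opsYOfRecordDE`

statement-level skeleton of published theorems with citation tags; proofs where landed; nothing here is a claim about the Yang–Mills mass gap

THE PRINT (pp. 419–427, 432).  p. 419: the identities *«D*J = 0»*, *«⟨A − Dλ, Δ(A − Dλ)⟩ = ⟨A, ΔA⟩ − ⟨i[…], …⟩ (3.117) … the error terms are small
because the function J = D*η⁻²Im ∂U is small»*; the gauge invariant extension *«⟨A, Δ_πA⟩ = ⟨A − DG′RD*A, Δ(A − DG′RD*A)⟩ (3.119)»* («the expression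
A − DG′RD*A … is obtained by gauge transforming an arbitrary configuration A to the subspace {A : RD*A = 0}»); applying (3.117): *«⟨A, Δ_πA⟩ = ⟨A, ΔA⟩ − …
= ⟨A, ΔA⟩ − ⟨A, Δ′_πA⟩ (3.120).  The quadratic form Δ′_π is a small perturbation of Δ»*.  p. 420: the Faddeev–Popov computation (3.121) and *«G⁻¹ defined
as G⁻¹ = Δ_π + DRD* + Q*aQ»* (3.122); the minimum *«A = GQ*ω, QGQ*ω = B, ω = (QGQ*)⁻¹B, and finally A = GQ*(QGQ*)⁻¹B»*, (3.124) *«QGDR = 0»*, hence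
*«HB = GQ*(QGQ*)⁻¹B (3.126).  We have obtained formally the same representation for the operator H as in [3, 4] (1.103), (2.35), but now the operator
G is much more complicated»*.  p. 421: the second variational problem (3.127) with [5]'s quadratic term `C⁽²⁾`, *«G₁ the operator defined by the
quadratic form … = ⟨A − DG′RD*A, Δ(A − DG′RD*A)⟩ − 2⟨HC⁽²⁾(A − DG′RD*A), J⟩ + ‖RD*A‖² + a‖QA‖² (3.128).  Then we have the formula H₁B = G₁Q*(QG₁Q*)⁻¹B
(3.129)»*; *«G₀ = (Δ + DRD* + Q*aQ)⁻¹.  From (3.120) we get G = (G₀⁻¹ − Δ′_π)⁻¹ = G₀(I − Δ′_πG₀)⁻¹ = Σₙ G₀(Δ′_πG₀)ⁿ (3.130)»*.  p. 422: (3.132) the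
expansion of `(QGQ*)⁻¹`; *«Let us define ⟨A, Δ⁽²⁾A⟩ … (3.134).  A meaning of Δ⁽²⁾ is obvious, it defines the second quadratic form in (3.128), i.e. we
have Δ⁽²⁾_π = Δ⁽²⁾ − DRG′D*Δ⁽²⁾ − Δ⁽²⁾DG′RD* + DRG′D*Δ⁽²⁾DG′RD* (3.135)»*.  p. 423: *«Similarly as in (3.130) we get G₁ = G₀(I − (Δ′_π + Δ⁽²⁾_π)G₀)⁻¹
= Σₙ G₀((Δ′_π + Δ⁽²⁾_π)G₀)ⁿ (3.138)»*; Thm 3.12.  p. 425: *«𝔓 = I − G₁Q*(QG₁Q*)⁻¹Q − G₁DRD*»* (3.147).  p. 426: *«𝔊 = 𝔓G₁ = G₁𝔓* = G₁ −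
G₁Q*(QG₁Q*)⁻¹QG₁ − G₁DRD*G₁ (3.153)»*; Thm 3.13.  pp. 426–427, Thm 3.14: *«we have two sequences of domains {Ω_j}, {Ω′_j} … We construct operators for
both sequences … If we take a pair of operators constructed for the two sequences {Ω_j}, {Ω′_j}, then their difference satisfies all the inequalities
characteristic for operators of the considered type, with the additional factor exp(−δ₀d(y, y′, Ω))»*.  p. 399: *«P = I − R»* (3.49) (R the site-sector
operator (3.21)∕(3.25)).  p. 432: *«C^{(k)}(Λ) = (I + D̄μ)QG̃₂Q*(I + μ*D̄*) (3.185)»* on functions *«g … defined at bonds of Λ»* ⊂ T₁^{(k)} (p. 427).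

WHY THIS FILE.  `Node00.OpsYOfLetters` (the interface `CovLettersY`) carries the Sect. D ∕ E letters `GD, G₁, GG, Kdiff, H, H₁, Ck, QGQinv, QG1Qinv,
P349` as parameters; def-Y's letters of record `lettersYOfRecord` (`Node00.OpsYDeltaA`, the v2 family) construct the Sect. B letters and leave those ten
slots at the flat `0` of `covLettersY_flat`, so that the N06 rows reading them (Thm 3.12, Thm 3.13, Thm 3.14, (3.132); Thm 3.15, (3.49)) are vacuous at
`opsYOfRecord` (n06-i's `B9RecordDELettersVacuity`, n06-m's `B9Thm314Thm315RecordVacuity`).  n06-i's `B9Eq3132SectDLetters` (p490565) then constructed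
THREE of them — Sect. D's `G_D = (Δ_π + DRD* + Q*aQ)⁻¹` (`GDY`), `(QGQ*)⁻¹` (`QGQinvY`), `H = GQ*(QGQ*)⁻¹` (`HDY`), with `π = gaugePiY`, `π† = gaugePiTY`,
`Δ_π = deltaPiY` (3.119), `G̃⁻¹ = deltaPiAY` (3.122) and the record update `withSectD` — and asked def-Y (pub-ymgap bus, 2026-08-27T03:10Z) to IMPORT those
and build the rest.  This file does exactly that: it imports `B9Eq3132SectDLetters`, re-types NONE of its letters, CONSTRUCTS the remaining five (`G₁, H₁,
QG1Qinv, GG` over the residual `Δ⁽²⁾`; `Kdiff` = Thm 3.14's difference) from the v2 primitives `D_U, D*_U, Δ(U), R(U), Q(U), Q*(U), a, G′(U)` exactly as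
printed, and files def-Y's v3 family and the instance `opsYOfRecordDE` under NEW names — `lettersYOfRecord`, `covLettersY_v2`, `opsYOfRecord`,
`covLettersY_v2D`, `lettersYSectD` are untouched (their `rfl` consumers stand), and v3 AGREES with `covLettersY_v2D` on `GD ∕ QGQinv ∕ H` by `rfl`.

WHAT IS DEFINED AND PROVED (sorry-free; no inequality of the paper).  All letters take `(i) (parS) (parB) (Gp) [Δ2] (U)` like n06-i's.
* §0 `ringInverse_mul_of_isUnit`, `ringInverse_sub_of_isUnit` — `(a − x)⁻¹ = a⁻¹(1 − xa⁻¹)⁻¹` for units (the resolvent step of (3.130)∕(3.138)).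
* §1 `deltaPiPrimeY := Δ(U) − Δ_π(U)` (3.120); for ANY bond-sector letter `G`: `QGQOfY = QGQ*`, `QGQinvOfY = (QGQ*)⁻¹`, `HOfY = GQ*(QGQ*)⁻¹` with
  `QGQY_eq_QGQOfY ∕ QGQinvY_eq_QGQinvOfY ∕ HDY_eq_HOfY` (n06-i's three are the case `G = G_D`, `rfl`).
* §2 over a residual bond-sector letter `Δ2 = Δ⁽²⁾(U)`: `delta2PiY := π†Δ⁽²⁾π` (3.135); `deltaOneY := G̃⁻¹ − Δ⁽²⁾_π` = the operator of the form (3.128);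
  ★ `G1Y := Ring.inverse deltaOneY` (3.128)∕(3.138); ★ `QG1QinvY := (QG₁Q*)⁻¹`, ★ `H1Y := G₁Q*(QG₁Q*)⁻¹` (3.129); `frakPY` = 𝔓 (3.147); ★ `GGY := 𝔓 ∘ G₁` = 𝔊
  (3.153); the SITE-sector `P349Y := I − R(U)` of (3.21)∕(3.49).
* §3 the printed algebra, kernel-checked: `deltaPiAY_eq_deltaAY_sub : G̃⁻¹ = Δ_a(U) − Δ′_π` ((3.122) vs (3.26)); ★ `GDY_eq_3130 : G = G₀(I − Δ′_πG₀)⁻¹` and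
  ★ `G1Y_eq_3138 : G₁ = G₀(I − (Δ′_π + Δ⁽²⁾_π)G₀)⁻¹` under the two unit hypotheses (`G₀ = GAY = Δ_a(U)⁻¹`); ★ `delta2PiY_eq_3135` ((3.135) verbatim),
  `deltaPiY_eq_expand`, `deltaPiPrimeY_eq_expand`; ★ `GGY_eq_3153 : 𝔊 = G₁ − G₁Q*(QG₁Q*)⁻¹QG₁ − G₁DRD*G₁`; `deltaOneY_mul_G1Y`, `G1Y_mul_deltaOneY`;
  `QY_comp_HOfY ∕ QY_comp_H1Y : Q ∘ H₁ = 1` wherever `QG₁Q*` is a unit («QH₁B = B»).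
* §4 at `U = 1`: `liftMatY_zero`, `curlY_one_comp_gradY_one`, `divY_one_comp_coCurlY_one`, `hessY_one_comp_gradY_one : Δ(1)D_1 = 0`, `divY_one_comp_hessY_one
  : D*_1Δ(1) = 0`; hence ★ **`deltaPiY_one' : Δ_π(1) = Δ(1)` for ANY `parS ∕ Gp`** (n06-i's `deltaPiY_one` needs the flat clauses), `deltaPiPrimeY_one :
  Δ′_π(1) = 0` (print: `J = 0` at `U = 1`), `deltaPiAY_one'`, `GDY_one'`; and for a residual letter with `Δ⁽²⁾(1) = 0`: `delta2PiY_one`, `deltaOneY_one`,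
  ★ `G1Y_one : G₁(1) = G(1)`, `G1Y_one_liftY : G₁(1)(J ⊗ E) = (Gop J) ⊗ E`, `G1Y_one_liftEndY`, `isUnit_deltaOneY_one`, `QGQOfY_G1Y_one`, `QG1QinvY_one :
  (QG₁Q*)⁻¹(1) = (QGQ*)⁻¹(1)`, `H1Y_one : H₁(1) = H(1)` (so n06-i's `QGQY_one_liftEndY ∕ isUnit_QGQY_one ∕ QGQinvY_one_liftEndY ∕ HDY_one` transfer).
* §5 `GAv2Y i` = v2's `G = Δ_a⁻¹` at an index (`covLettersY_v2_GA_eq`, `rfl`); `GAsndY x = G(Ω′, ·)` — the same operator constructed for the member's SECOND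
  sequence `{Ω′_j}` (index `x.snd`; same torus, so the carriers agree definitionally); ★ **`KdiffY x := G(Ω, ·) − G(Ω′, ·)`** (Thm 3.14); `KdiffY_diag`
  (at a diagonal member, `{Ω′_j} = {Ω_j}`, it is `0`).
* §6 `ResLettersY` = the residual letter `Δ⁽²⁾` with its printed `U = 1` clause `Δ⁽²⁾(1) = 0`, `resLettersY_flat`; ★ **`CovLettersY.withDE 𝔏 GA' 𝔯`** (the
  record update filling `G₁, GG, Kdiff, H₁, QG1Qinv` — NOT `GD ∕ H ∕ QGQinv`, which are `withSectD`'s; fifteen `rfl` field lemmas; `withSectD_withDE_comm :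
  withSectD (𝔏.withDE …) = (withSectD 𝔏).withDE …`, `rfl`; `withDE_G₁_one`); ★★ **`covLettersY_v3 𝔸 x 𝔯 := withSectD 𝔸 ((covLettersY_v2 𝔸 x).withDE 𝔸
  (GAsndY 𝔸 x) 𝔯)`** with its field lemmas (`covLettersY_v3_Kdiff : … = KdiffY 𝔸 x`; `covLettersY_v3_sectD_eq_v2D`; `covLettersY_v3_QGQinv_QG1Qinv_ringInverse`
  — both (3.132) letters are `Ring.inverse` of named operators, the `hT ∕ hT₁ := fun _ _ => rfl` shape of n06-i's
  `B9Eq3132RingInverseReading.stmt3132Printed_opsYOfLetters_of_ringInverse`; `covLettersY_v3_P349 ∕ _Ck : … = 0`, LOCATED).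
* §7 `ResY`, `resY_flat`; ★★★ **`lettersYOfRecordDE N θ M⋆ 𝔯`** and **`opsYOfRecordDE N θ M⋆ 𝔯 𝔈 := opsYOfLetters N θ M⋆ (lettersYOfRecordDE N θ M⋆ 𝔯) 𝔈`**;
  `lettersYResOfRecord` with ★ `lettersYOfRecordDE_eq_withSectD : lettersYOfRecordDE … 𝔯 = fun x => withSectD _ (lettersYResOfRecord … 𝔯 x)` (`rfl` — the
  syntactic shape n06-i's `s3132_withSectD` quantifies over); `opsYOfRecordDE_eq`, `lettersYOfRecordDE_apply`, `lettersYOfRecordDE_GA` (the Sect. B letters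
  ARE those of `lettersYOfRecord`, `rfl`), `lettersYOfRecordDE_sectD` (`GD ∕ QGQinv ∕ H` ARE those of `lettersYSectD`, `rfl`), `lettersYOfRecordDE_G₁`,
  `lettersYOfRecordDE_G₁_one`, `lettersYOfRecordDE_Kdiff`, `lettersYOfRecordDE_P349_Ck`, `Y9OfRecord_opsYOfRecordDE`.
* §G (3.33)–(3.34) for the Sect. D letters, by FILE 6's intertwining engine (`Node00.OpsYGauge`: `Intw`, `conjY`, `gradY_cov … hessY_cov`, `RY_cov`, `GAY_cov`,
  `Intw.ringInverse`): `IsCovBondOpY` (a covariant bond-sector letter), `isCovBondOpY_zero`, `GAY_isCovBondOpY`; ★ `gaugePiY_cov`, `gaugePiTY_cov` («A − DG′RD*A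
  has this invariance property», p.419), ★ `deltaPiY_cov`, `deltaPiPrimeY_cov`, `deltaPiAY_cov`, ★★ **`GDY_cov : G(U^u)R(u) = R(u)G(U)`** for Sect. D's `G`,
  `QGQOfY_cov ∕ QGQinvOfY_cov ∕ HOfY_cov` (any covariant `G`), `QGQY_cov`, ★ `QGQinvY_cov`, ★ `HDY_cov`; for a covariant residual `Δ⁽²⁾`: `delta2PiY_cov`,
  `deltaOneY_cov`, ★★ `G1Y_cov`, `QG1QinvY_cov`, `H1Y_cov`, `frakPY_cov`, ★ `GGY_cov`; `P349Y_cov`; §G′ `GAv2Y_isCovBondOpY`, `GAsndY_isCovBondOpY` (same torus, same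
  gauge functions), ★★ **`KdiffY_cov`** (Thm 3.14's letter), ★★★ `covLettersY_v3_cov` and **`lettersYOfRecordDE_cov`** (the eight D∕E letters of the v3 record are
  covariant, given `IsCovBondOpY _ (𝔯 x).Δ2`; the Sect. B letters by `lettersYOfRecord_cov`).

MODEL ∕ DECLARED READINGS.  (M1)–(M4) as in `Node00.OpsYDeltaA` (fibre any complete normed ℂ-algebra `𝔸`; trace-pairing transposes for adjoints: `π†`
is the transpose of `π` by the `divY_eq_transpose`-type bookkeeping of that file, not by an inner product on `𝔸`; every inverse is a `Ring.inverse` in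
`Module.End ℂ` — the genuine inverse wherever the operator is a unit, which away from `U = 1` is the CONTENT of (3.130)–(3.131), (3.138), Thm 3.12 and
is NOT claimed).  (M5) `Δ′_π` is DEFINED by the first equality of (3.120) (`Δ − Δ_π`); its explicit `J`-form (the middle of (3.120)) is (3.117), a
statement about `Δ(U)` not proved here.  (M6) THE RESIDUAL LETTER: `Δ⁽²⁾(U)` of (3.134) is built in print from [5]'s second-order term `C⁽²⁾` of the
non-linear averaging and the field `J = D*η⁻²Im ∂U`; neither is an object of NODE 00's tree, so `Δ⁽²⁾` is a PARAMETER (`ResLettersY.Δ2`, one per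
member: `ResY`) with its `U = 1` clause; `G₁, H₁, (QG₁Q*)⁻¹, 𝔊` are genuine FUNCTIONS of it ((3.128), (3.129), (3.132), (3.153) verbatim).  (M7) THM
3.14's LETTER is typed for the operator `G = Δ_a⁻¹` of Thm 3.3 (the four entries `Thm314Printed` reads), the second-sequence operator being def-Y's v2
`G` at the index `x.snd`; `CovLettersY.withDE` takes the second-sequence operator as an argument `GA'` (a `CovLettersY` record carries letters at
`x.toKIdx` only).  (M8) LOCATED (interface finding, not repaired here): the slots `CovLettersY.P349 : BondOpY` and `CovLettersY.Ck : (BlkY → 𝔸) →ₗ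
(BlkY → 𝔸)` cannot hold the printed objects — `P = I − R` (3.49) acts on SITE functions (`R` is the site-sector (3.21)∕(3.25); typed here as `P349Y :
SiteOpY`), and `C^{(k)}(Λ)` (3.185) acts on unit-lattice BOND functions (level-`k` index bonds, as `inΛY` ∕ `Thm315Printed` already read `y`); so
`covLettersY_v3` leaves both slots at the flat `0`, and the rows (3.49) ∕ Thm 3.15 of the N06 table remain vacuous at `opsYOfRecordDE` exactly as at
`opsYOfRecord` — a successor interface with a site-sector `P349`, a coarse-bond-sector `Ck` and the Sect. E letters `μ, D̄, G̃₂` of (3.163)–(3.184) is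
the separate brick.
HONEST SCOPE.  Exact finite-dimensional lattice algebra realising the printed FORMULAS of Sect. D as functions of `U` on NODE 00's carriers, with the
printed identities among them PROVED and the `U = 1` identifications PROVED; no inequality of the paper ((3.131), (3.133), (3.137), Thms 3.12–3.15
are hypotheses of the N06 knit, now readable at genuine letters: `GD, H, QGQinv` (n06-i's), `Kdiff` outright, `G₁, H₁, QG1Qinv, GG` modulo the residual `Δ⁽²⁾`);
The gauge covariance §G is exact algebra ((3.33)–(3.34) pattern; `Ring.inverse` commutes with conjugation by the invertible `R(u)`).  NOT summit
progress.  Consumers: dag-n06-d's knit (re-instantiation `𝔏 := lettersYOfRecordDE …`, same constructor `opsYOfLetters`), n06-i ∕ n06-l ∕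
n06-m (rows (3.132), Thms 3.12–3.14 stop being flat-`0` rows).  Filed by the pub-ymgap def-Y owner lineage (`pub-ymgap-node00-def-Y`, gen 3); a NEW
file; nothing landed is modified.  Net new unproved facts: 0.
-/

namespace Literature.MathematicalPhysics.QuantumFieldTheory.Balaban1983to89.Node00

open B6KLevelCensusIndexV1 (KIdx)
open B9PinMembersKLevelV1 (MemberY)
open B9PinCarriersKLevelV1 (carriersY)
open B7Prop2SpecialUnitary (specialUnitaryUnits)
open B6Prop26Census2136KLevelV1 (Gop)
open B9Eq3132SectDLetters (gaugePiY gaugePiTY deltaPiY deltaPiAY GDY QGQY QGQinvY HDY withSectD covLettersY_v2D lettersYSectD)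
open scoped Matrix

noncomputable section

variable {d ℓ : ℕ} {hd : 1 ≤ d + 1} {hL : Odd (ℓ + 1) ∧ 1 < ℓ + 1} {b₀ b₁ : ℝ} {Mstar : ℕ}
variable {𝔸 : Type} [NormedRing 𝔸] [NormedAlgebra ℂ 𝔸] [CompleteSpace 𝔸]

/-! ## §0 Two lines of `Ring.inverse` algebra in a noncommutative ring (the resolvent step of (3.130) ∕ (3.138)) -/

section RingInverse

/-- `(ab)⁻¹ = b⁻¹a⁻¹` for units, `Ring.inverse` form. [cite: Balaban1985BackgroundPropagators, (3.130) p.421, bookkeeping] -/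
theorem ringInverse_mul_of_isUnit {R : Type} [MonoidWithZero R] {a b : R} (ha : IsUnit a) (hb : IsUnit b) :
    Ring.inverse (a * b) = Ring.inverse b * Ring.inverse a := by
  obtain ⟨ua, rfl⟩ := ha
  obtain ⟨ub, rfl⟩ := hb
  rw [← Units.val_mul, Ring.inverse_unit, Ring.inverse_unit, Ring.inverse_unit, mul_inv_rev, Units.val_mul]

/-- the resolvent identity `(a − x)⁻¹ = a⁻¹(1 − x a⁻¹)⁻¹` for a unit `a` and a unit `1 − x a⁻¹` — print's step from `G⁻¹ = G₀⁻¹ − Δ′_π` to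
`G = G₀(I − Δ′_πG₀)⁻¹`. [cite: Balaban1985BackgroundPropagators, (3.130) p.421, (3.138) p.423] -/
theorem ringInverse_sub_of_isUnit {R : Type} [Ring R] {a x : R} (ha : IsUnit a) (h : IsUnit (1 - x * Ring.inverse a)) :
    Ring.inverse (a - x) = Ring.inverse a * Ring.inverse (1 - x * Ring.inverse a) := by
  have e : a - x = (1 - x * Ring.inverse a) * a := by
    rw [sub_mul, one_mul, mul_assoc, Ring.inverse_mul_cancel _ ha, mul_one]
  rw [e, ringInverse_mul_of_isUnit h ha]

end RingInverse

/-! ## §1 `Δ′_π` (3.120); `QGQ*`, `(QGQ*)⁻¹`, `GQ*(QGQ*)⁻¹` for ANY bond-sector letter `G` (n06-i's `QGQY ∕ QGQinvY ∕ HDY` are the case `G = G_D`) -/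

section Letters

variable (i : KIdx d ℓ hd hL b₀ b₁)

/-- `Δ′_π(U) := Δ(U) − Δ_π(U)` — the operator of the correction form in (3.120) `⟨A, Δ_πA⟩ = ⟨A, ΔA⟩ − ⟨A, Δ′_πA⟩` (`Δ_π` = n06-i's `deltaPiY`
(3.119)). [cite: Balaban1985BackgroundPropagators, (3.120) p.419] -/
def deltaPiPrimeY (parS : SiteParY 𝔸 i) (Gp : SiteOpY 𝔸 i) (U : CfgY 𝔸 i) : (FBondY i → 𝔸) →ₗ[ℂ] (FBondY i → 𝔸) :=
  hessY i U - deltaPiY i parS Gp U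

/-- `Q(U) G(U) Q*(U)` on coarse-bond functions, for a bond-sector letter `G`. [cite: Balaban1985BackgroundPropagators, (3.132) p.422] -/
def QGQOfY (parB : BondParY 𝔸 i) (G : BondOpY 𝔸 i) (U : CfgY 𝔸 i) : (IBondY i → 𝔸) →ₗ[ℂ] (IBondY i → 𝔸) :=
  QY i parB U ∘ₗ G U ∘ₗ QsY i parB U

/-- `(Q G Q*)⁻¹(U)` (`Ring.inverse`), for a bond-sector letter `G`. [cite: Balaban1985BackgroundPropagators, (3.132) p.422] -/
def QGQinvOfY (parB : BondParY 𝔸 i) (G : BondOpY 𝔸 i) (U : CfgY 𝔸 i) : (IBondY i → 𝔸) →ₗ[ℂ] (IBondY i → 𝔸) :=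
  Ring.inverse (QGQOfY i parB G U)

/-- `H := G Q*(Q G Q*)⁻¹` — the minimizer map (3.123)–(3.126) for the letter `G`. [cite: Balaban1985BackgroundPropagators, (3.123)–(3.126) pp.420–421] -/
def HOfY (parB : BondParY 𝔸 i) (G : BondOpY 𝔸 i) (U : CfgY 𝔸 i) : (IBondY i → 𝔸) →ₗ[ℂ] (FBondY i → 𝔸) :=
  G U ∘ₗ QsY i parB U ∘ₗ QGQinvOfY i parB G U

/-- n06-i's `QGQY` is the case `G = G_D`. [cite: Balaban1985BackgroundPropagators, (3.123) p.420, bookkeeping] -/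
theorem QGQY_eq_QGQOfY (parS : SiteParY 𝔸 i) (parB : BondParY 𝔸 i) (Gp : SiteOpY 𝔸 i) (U : CfgY 𝔸 i) :
    QGQY i parS parB Gp U = QGQOfY i parB (GDY i parS parB Gp) U := rfl

/-- n06-i's `QGQinvY` is the case `G = G_D`. [cite: Balaban1985BackgroundPropagators, (3.132) p.422, bookkeeping] -/
theorem QGQinvY_eq_QGQinvOfY (parS : SiteParY 𝔸 i) (parB : BondParY 𝔸 i) (Gp : SiteOpY 𝔸 i) (U : CfgY 𝔸 i) :
    QGQinvY i parS parB Gp U = QGQinvOfY i parB (GDY i parS parB Gp) U := rfl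

/-- n06-i's `HDY` is the case `G = G_D`. [cite: Balaban1985BackgroundPropagators, (3.126) p.421, bookkeeping] -/
theorem HDY_eq_HOfY (parS : SiteParY 𝔸 i) (parB : BondParY 𝔸 i) (Gp : SiteOpY 𝔸 i) (U : CfgY 𝔸 i) :
    HDY i parS parB Gp U = HOfY i parB (GDY i parS parB Gp) U := rfl

/-! ## §2 `Δ⁽²⁾_π` (3.135), `G₁` ((3.128), (3.138)), `(QG₁Q*)⁻¹` (3.132), `H₁` (3.129), `𝔓` (3.147), `𝔊 = 𝔓G₁` (3.153) over a residual letter `Δ⁽²⁾(U)`;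
the site-sector `P = I − R` (3.49) -/

/-- `Δ⁽²⁾_π(U) := π† Δ⁽²⁾(U) π` — (3.135) before expansion, for a bond-sector letter `Δ⁽²⁾(U)` (the operator (3.134) of the form `2⟨HC⁽²⁾(A), J⟩`),
`π = gaugePiY`, `π† = gaugePiTY`. [cite: Balaban1985BackgroundPropagators, (3.134)–(3.135) p.422] -/
def delta2PiY (parS : SiteParY 𝔸 i) (Gp : SiteOpY 𝔸 i) (Δ2 : BondOpY 𝔸 i) (U : CfgY 𝔸 i) : (FBondY i → 𝔸) →ₗ[ℂ] (FBondY i → 𝔸) :=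
  gaugePiTY i parS Gp U ∘ₗ Δ2 U ∘ₗ gaugePiY i parS Gp U

/-- `G₁(U)⁻¹ := G̃⁻¹ − Δ⁽²⁾_π = Δ_π − Δ⁽²⁾_π + DRD* + Q*aQ` — the operator of the form (3.128) after (3.134) (`G̃⁻¹` = n06-i's `deltaPiAY` (3.122)).
[cite: Balaban1985BackgroundPropagators, (3.128) p.421, (3.134) p.422, (3.138) p.423] -/
def deltaOneY (parS : SiteParY 𝔸 i) (parB : BondParY 𝔸 i) (Gp : SiteOpY 𝔸 i) (Δ2 : BondOpY 𝔸 i) (U : CfgY 𝔸 i) :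
    (FBondY i → 𝔸) →ₗ[ℂ] (FBondY i → 𝔸) :=
  deltaPiAY i parS parB Gp U - delta2PiY i parS Gp Δ2 U

/-- ★ `G₁(U)` (3.128)–(3.129) (`Ring.inverse`: the genuine inverse wherever (3.128) is invertible — the content of (3.138), not claimed).
[cite: Balaban1985BackgroundPropagators, (3.128)–(3.129) p.421, (3.138) p.423] -/
def G1Y (parS : SiteParY 𝔸 i) (parB : BondParY 𝔸 i) (Gp : SiteOpY 𝔸 i) (Δ2 : BondOpY 𝔸 i) : BondOpY 𝔸 i :=
  fun U => Ring.inverse (deltaOneY i parS parB Gp Δ2 U)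

/-- ★ `(Q G₁ Q*)⁻¹(U)` — the `QG1Qinv` letter of (3.132). [cite: Balaban1985BackgroundPropagators, (3.132) p.422] -/
def QG1QinvY (parS : SiteParY 𝔸 i) (parB : BondParY 𝔸 i) (Gp : SiteOpY 𝔸 i) (Δ2 : BondOpY 𝔸 i) :
    CfgY 𝔸 i → (IBondY i → 𝔸) →ₗ[ℂ] (IBondY i → 𝔸) :=
  QGQinvOfY i parB (G1Y i parS parB Gp Δ2)

/-- ★ `H₁(U) = G₁Q*(QG₁Q*)⁻¹` — the `H₁` letter of (3.129). [cite: Balaban1985BackgroundPropagators, (3.129) p.421] -/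
def H1Y (parS : SiteParY 𝔸 i) (parB : BondParY 𝔸 i) (Gp : SiteOpY 𝔸 i) (Δ2 : BondOpY 𝔸 i) :
    CfgY 𝔸 i → (IBondY i → 𝔸) →ₗ[ℂ] (FBondY i → 𝔸) :=
  HOfY i parB (G1Y i parS parB Gp Δ2)

/-- `𝔓 := I − G₁Q*(QG₁Q*)⁻¹Q − G₁DRD*` of (3.147). [cite: Balaban1985BackgroundPropagators, (3.147) p.425] -/
def frakPY (parS : SiteParY 𝔸 i) (parB : BondParY 𝔸 i) (Gp : SiteOpY 𝔸 i) (Δ2 : BondOpY 𝔸 i) (U : CfgY 𝔸 i) :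
    (FBondY i → 𝔸) →ₗ[ℂ] (FBondY i → 𝔸) :=
  LinearMap.id - G1Y i parS parB Gp Δ2 U ∘ₗ QsY i parB U ∘ₗ QG1QinvY i parS parB Gp Δ2 U ∘ₗ QY i parB U
    - G1Y i parS parB Gp Δ2 U ∘ₗ gradY i U ∘ₗ RY i parS Gp U ∘ₗ divY i U

/-- ★ `𝔊 := 𝔓 G₁` — the `GG` letter of (3.145) ∕ (3.153) (`= G₁𝔓*`, expanded in `GGY_eq_3153`). [cite: Balaban1985BackgroundPropagators, (3.145) p.424, (3.153) p.426] -/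
def GGY (parS : SiteParY 𝔸 i) (parB : BondParY 𝔸 i) (Gp : SiteOpY 𝔸 i) (Δ2 : BondOpY 𝔸 i) : BondOpY 𝔸 i :=
  fun U => frakPY i parS parB Gp Δ2 U ∘ₗ G1Y i parS parB Gp Δ2 U

/-- the SITE-sector projection `P := I − R(U)` of (3.21) ∕ (3.49) (`R` = `RY`, the algebraic (3.25) operator on site functions) — the printed object of
row (3.49), which the bond-sector slot `CovLettersY.P349` cannot hold (file header, (M8)). [cite: Balaban1985BackgroundPropagators, (3.21) p.394, (3.49) p.399] -/
def P349Y (parS : SiteParY 𝔸 i) (Gp : SiteOpY 𝔸 i) : SiteOpY 𝔸 i := fun U => LinearMap.id - RY i parS Gp U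

/-! ## §3 The printed algebra: (3.122) vs (3.26), the resolvent forms (3.130) and (3.138), the expansions (3.119)∕(3.135) and (3.153), `QH₁ = 1` -/

variable {i}

/-- (3.121)–(3.122) against (3.26): `G̃⁻¹ = Δ_a(U) − Δ′_π = G₀⁻¹ − Δ′_π` («G = (G₀⁻¹ − Δ′_π)⁻¹», (3.130)), `G₀ = Δ_a⁻¹` the operator of Thm 3.3.
[cite: Balaban1985BackgroundPropagators, (3.122) p.420, (3.130) p.421] -/
theorem deltaPiAY_eq_deltaAY_sub (parS : SiteParY 𝔸 i) (parB : BondParY 𝔸 i) (Gp : SiteOpY 𝔸 i) (U : CfgY 𝔸 i) :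
    deltaPiAY i parS parB Gp U = deltaAY i parS parB Gp U - deltaPiPrimeY i parS Gp U := by
  simp only [deltaPiAY, deltaAY, deltaPiPrimeY]
  abel

/-- ★ **(3.130)**: `G = G₀(I − Δ′_πG₀)⁻¹` wherever `G₀⁻¹ = Δ_a(U)` and `I − Δ′_πG₀` are invertible (print then expands the Neumann series; the
smallness (3.131) of `Δ′_π` is NOT claimed). [cite: Balaban1985BackgroundPropagators, (3.130)–(3.131) p.421] -/
theorem GDY_eq_3130 {parS : SiteParY 𝔸 i} {parB : BondParY 𝔸 i} {Gp : SiteOpY 𝔸 i} {U : CfgY 𝔸 i} (hA : IsUnit (deltaAY i parS parB Gp U))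
    (h : IsUnit (1 - deltaPiPrimeY i parS Gp U * GAY i parS parB Gp U)) :
    GDY i parS parB Gp U = GAY i parS parB Gp U * Ring.inverse (1 - deltaPiPrimeY i parS Gp U * GAY i parS parB Gp U) := by
  show Ring.inverse (deltaPiAY i parS parB Gp U) = _
  rw [deltaPiAY_eq_deltaAY_sub]
  exact ringInverse_sub_of_isUnit hA h

/-- `G₁⁻¹ = G₀⁻¹ − (Δ′_π + Δ⁽²⁾_π)` (the form behind (3.138)). [cite: Balaban1985BackgroundPropagators, (3.128) p.421, (3.138) p.423] -/
theorem deltaOneY_eq_deltaAY_sub (parS : SiteParY 𝔸 i) (parB : BondParY 𝔸 i) (Gp : SiteOpY 𝔸 i) (Δ2 : BondOpY 𝔸 i) (U : CfgY 𝔸 i) :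
    deltaOneY i parS parB Gp Δ2 U = deltaAY i parS parB Gp U - (deltaPiPrimeY i parS Gp U + delta2PiY i parS Gp Δ2 U) := by
  rw [deltaOneY, deltaPiAY_eq_deltaAY_sub, sub_sub]

/-- ★ **(3.138)**: `G₁ = G₀(I − (Δ′_π + Δ⁽²⁾_π)G₀)⁻¹` wherever `Δ_a(U)` and `I − (Δ′_π + Δ⁽²⁾_π)G₀` are invertible («similarly as in (3.130)»).
[cite: Balaban1985BackgroundPropagators, (3.138) p.423] -/
theorem G1Y_eq_3138 {parS : SiteParY 𝔸 i} {parB : BondParY 𝔸 i} {Gp : SiteOpY 𝔸 i} {Δ2 : BondOpY 𝔸 i} {U : CfgY 𝔸 i}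
    (hA : IsUnit (deltaAY i parS parB Gp U))
    (h : IsUnit (1 - (deltaPiPrimeY i parS Gp U + delta2PiY i parS Gp Δ2 U) * GAY i parS parB Gp U)) :
    G1Y i parS parB Gp Δ2 U =
      GAY i parS parB Gp U * Ring.inverse (1 - (deltaPiPrimeY i parS Gp U + delta2PiY i parS Gp Δ2 U) * GAY i parS parB Gp U) := by
  show Ring.inverse (deltaOneY i parS parB Gp Δ2 U) = _
  rw [deltaOneY_eq_deltaAY_sub]
  exact ringInverse_sub_of_isUnit hA h

/-- `G₁(U)⁻¹·G₁(U) = 1` wherever (3.128) is invertible. [cite: Balaban1985BackgroundPropagators, (3.128) p.421, bookkeeping] -/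
theorem deltaOneY_mul_G1Y {parS : SiteParY 𝔸 i} {parB : BondParY 𝔸 i} {Gp : SiteOpY 𝔸 i} {Δ2 : BondOpY 𝔸 i} {U : CfgY 𝔸 i}
    (hU : IsUnit (deltaOneY i parS parB Gp Δ2 U)) : deltaOneY i parS parB Gp Δ2 U * G1Y i parS parB Gp Δ2 U = 1 :=
  Ring.mul_inverse_cancel _ hU

/-- `G₁(U)·G₁(U)⁻¹ = 1` wherever (3.128) is invertible. [cite: Balaban1985BackgroundPropagators, (3.128) p.421, bookkeeping] -/
theorem G1Y_mul_deltaOneY {parS : SiteParY 𝔸 i} {parB : BondParY 𝔸 i} {Gp : SiteOpY 𝔸 i} {Δ2 : BondOpY 𝔸 i} {U : CfgY 𝔸 i}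
    (hU : IsUnit (deltaOneY i parS parB Gp Δ2 U)) : G1Y i parS parB Gp Δ2 U * deltaOneY i parS parB Gp Δ2 U = 1 :=
  Ring.inverse_mul_cancel _ hU

/-- ★ **(3.135) verbatim**: `Δ⁽²⁾_π = Δ⁽²⁾ − DRG′D*Δ⁽²⁾ − Δ⁽²⁾DG′RD* + DRG′D*Δ⁽²⁾DG′RD*`. [cite: Balaban1985BackgroundPropagators, (3.135) p.422] -/
theorem delta2PiY_eq_3135 (parS : SiteParY 𝔸 i) (Gp : SiteOpY 𝔸 i) (Δ2 : BondOpY 𝔸 i) (U : CfgY 𝔸 i) :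
    delta2PiY i parS Gp Δ2 U =
      Δ2 U - gradY i U ∘ₗ RY i parS Gp U ∘ₗ Gp U ∘ₗ divY i U ∘ₗ Δ2 U
        - Δ2 U ∘ₗ gradY i U ∘ₗ Gp U ∘ₗ RY i parS Gp U ∘ₗ divY i U
        + gradY i U ∘ₗ RY i parS Gp U ∘ₗ Gp U ∘ₗ divY i U ∘ₗ Δ2 U ∘ₗ gradY i U ∘ₗ Gp U ∘ₗ RY i parS Gp U ∘ₗ divY i U := by
  simp only [delta2PiY, gaugePiTY, gaugePiY, LinearMap.sub_comp, LinearMap.comp_sub, LinearMap.id_comp, LinearMap.comp_id, LinearMap.comp_assoc]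
  abel

/-- (3.119) expanded the same way: `Δ_π = Δ − DRG′D*Δ − ΔDG′RD* + DRG′D*ΔDG′RD*`. [cite: Balaban1985BackgroundPropagators, (3.119) p.419, bookkeeping] -/
theorem deltaPiY_eq_expand (parS : SiteParY 𝔸 i) (Gp : SiteOpY 𝔸 i) (U : CfgY 𝔸 i) :
    deltaPiY i parS Gp U =
      hessY i U - gradY i U ∘ₗ RY i parS Gp U ∘ₗ Gp U ∘ₗ divY i U ∘ₗ hessY i U
        - hessY i U ∘ₗ gradY i U ∘ₗ Gp U ∘ₗ RY i parS Gp U ∘ₗ divY i U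
        + gradY i U ∘ₗ RY i parS Gp U ∘ₗ Gp U ∘ₗ divY i U ∘ₗ hessY i U ∘ₗ gradY i U ∘ₗ Gp U ∘ₗ RY i parS Gp U ∘ₗ divY i U := by
  simp only [deltaPiY, gaugePiTY, gaugePiY, LinearMap.sub_comp, LinearMap.comp_sub, LinearMap.id_comp, LinearMap.comp_id, LinearMap.comp_assoc]
  abel

/-- `Δ′_π` expanded: `Δ′_π = DRG′D*Δ + ΔDG′RD* − DRG′D*ΔDG′RD*`. [cite: Balaban1985BackgroundPropagators, (3.120) p.419, bookkeeping] -/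
theorem deltaPiPrimeY_eq_expand (parS : SiteParY 𝔸 i) (Gp : SiteOpY 𝔸 i) (U : CfgY 𝔸 i) :
    deltaPiPrimeY i parS Gp U =
      gradY i U ∘ₗ RY i parS Gp U ∘ₗ Gp U ∘ₗ divY i U ∘ₗ hessY i U + hessY i U ∘ₗ gradY i U ∘ₗ Gp U ∘ₗ RY i parS Gp U ∘ₗ divY i U
        - gradY i U ∘ₗ RY i parS Gp U ∘ₗ Gp U ∘ₗ divY i U ∘ₗ hessY i U ∘ₗ gradY i U ∘ₗ Gp U ∘ₗ RY i parS Gp U ∘ₗ divY i U := by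
  rw [deltaPiPrimeY, deltaPiY_eq_expand]
  abel

/-- ★ **(3.153) verbatim**: `𝔊 = 𝔓G₁ = G₁ − G₁Q*(QG₁Q*)⁻¹QG₁ − G₁DRD*G₁` (`= G₁𝔓*`). [cite: Balaban1985BackgroundPropagators, (3.153) p.426] -/
theorem GGY_eq_3153 (parS : SiteParY 𝔸 i) (parB : BondParY 𝔸 i) (Gp : SiteOpY 𝔸 i) (Δ2 : BondOpY 𝔸 i) (U : CfgY 𝔸 i) :
    GGY i parS parB Gp Δ2 U =
      G1Y i parS parB Gp Δ2 U
        - G1Y i parS parB Gp Δ2 U ∘ₗ QsY i parB U ∘ₗ QG1QinvY i parS parB Gp Δ2 U ∘ₗ QY i parB U ∘ₗ G1Y i parS parB Gp Δ2 U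
        - G1Y i parS parB Gp Δ2 U ∘ₗ gradY i U ∘ₗ RY i parS Gp U ∘ₗ divY i U ∘ₗ G1Y i parS parB Gp Δ2 U := by
  simp only [GGY, frakPY, LinearMap.sub_comp, LinearMap.id_comp, LinearMap.comp_assoc]

/-- `H₁ = G₁Q*(QG₁Q*)⁻¹` unfolded. [cite: Balaban1985BackgroundPropagators, (3.129) p.421, bookkeeping] -/
theorem H1Y_eq (parS : SiteParY 𝔸 i) (parB : BondParY 𝔸 i) (Gp : SiteOpY 𝔸 i) (Δ2 : BondOpY 𝔸 i) (U : CfgY 𝔸 i) :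
    H1Y i parS parB Gp Δ2 U = G1Y i parS parB Gp Δ2 U ∘ₗ QsY i parB U ∘ₗ QG1QinvY i parS parB Gp Δ2 U := rfl

/-- `Q H = 1` on coarse-bond functions wherever `QGQ*` is invertible, for any letter `G` («QHB = B»: `HB` satisfies the constraint `QA = B`).
[cite: Balaban1985BackgroundPropagators, (3.123)–(3.126) pp.420–421] -/
theorem QY_comp_HOfY {parB : BondParY 𝔸 i} {G : BondOpY 𝔸 i} {U : CfgY 𝔸 i} (hU : IsUnit (QGQOfY i parB G U)) :
    QY i parB U ∘ₗ HOfY i parB G U = LinearMap.id := by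
  rw [HOfY, QGQinvOfY, ← LinearMap.comp_assoc, ← LinearMap.comp_assoc]
  exact Ring.mul_inverse_cancel _ hU

/-- `Q H₁ = 1` wherever `QG₁Q*` is invertible («H₁B» satisfies `QA = B`, (3.127)∕(3.110)). [cite: Balaban1985BackgroundPropagators, (3.129) p.421] -/
theorem QY_comp_H1Y {parS : SiteParY 𝔸 i} {parB : BondParY 𝔸 i} {Gp : SiteOpY 𝔸 i} {Δ2 : BondOpY 𝔸 i} {U : CfgY 𝔸 i}
    (hU : IsUnit (QGQOfY i parB (G1Y i parS parB Gp Δ2) U)) : QY i parB U ∘ₗ H1Y i parS parB Gp Δ2 U = LinearMap.id :=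
  QY_comp_HOfY hU

/-! ## §4 At `U = 1`: `Δ_π(1) = Δ(1)` WITHOUT hypotheses on the transporters (since `Δ(1)D_1 = 0`, `D*_1Δ(1) = 0`), `Δ′_π(1) = 0`, and for a residual
letter with `Δ⁽²⁾(1) = 0`: `G₁(1) = G(1) = Gop♯` -/

section AtOne

variable (i)

omit [CompleteSpace 𝔸] in
/-- the lift of the zero matrix is `0`. [cite: Balaban1985BackgroundPropagators, p.395, bookkeeping] -/
theorem liftMatY_zero {X Y : Type} [Fintype X] [Fintype Y] : liftMatY 𝔸 (0 : Matrix Y X ℝ) = 0 := by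
  have h := liftMatY_sub 𝔸 (0 : Matrix Y X ℝ) 0
  rwa [sub_self, sub_self] at h

/-- at `U = 1`: `curl_1 ∘ D_1 = 0` (n06-i's flat `curlK_mul_gradK`, lifted). [cite: Balaban1985BackgroundPropagators, (3.3)–(3.4) pp.390–391, bookkeeping] -/
theorem curlY_one_comp_gradY_one : curlY (𝔸 := 𝔸) i (fun _ _ => 1) ∘ₗ gradY i (fun _ _ => 1) = 0 := by
  rw [curlY_one, gradY_one, ← liftMatY_mul, B9Eq3132SectDLetters.curlK_mul_gradK, liftMatY_zero]

/-- at `U = 1`: `D*_1 ∘ cocurl_1 = 0`. [cite: Balaban1985BackgroundPropagators, (3.8)–(3.9) p.392, bookkeeping] -/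
theorem divY_one_comp_coCurlY_one : divY (𝔸 := 𝔸) i (fun _ _ => 1) ∘ₗ coCurlY i (fun _ _ => 1) = 0 := by
  rw [divY_one, coCurlY_one, ← liftMatY_mul, B9Eq3132SectDLetters.divK_mul_cocurlK, liftMatY_zero]

/-- at `U = 1` the Hessian is `∂ᶜ*_1 ∘ ∂ᶜ_1` in letters. [cite: Balaban1985BackgroundPropagators, (3.10) p.392, bookkeeping] -/
theorem hessY_one_eq_comp : hessY (𝔸 := 𝔸) i (fun _ _ => 1) = coCurlY i (fun _ _ => 1) ∘ₗ curlY i (fun _ _ => 1) := by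
  rw [hessY_one, coCurlY_one, curlY_one]

/-- at `U = 1`: `Δ(1) ∘ D_1 = 0`. [cite: Balaban1985BackgroundPropagators, (3.10) p.392, bookkeeping] -/
theorem hessY_one_comp_gradY_one : hessY (𝔸 := 𝔸) i (fun _ _ => 1) ∘ₗ gradY i (fun _ _ => 1) = 0 := by
  rw [hessY_one_eq_comp, LinearMap.comp_assoc, curlY_one_comp_gradY_one, LinearMap.comp_zero]

/-- at `U = 1`: `D*_1 ∘ Δ(1) = 0`. [cite: Balaban1985BackgroundPropagators, (3.10) p.392, bookkeeping] -/
theorem divY_one_comp_hessY_one : divY (𝔸 := 𝔸) i (fun _ _ => 1) ∘ₗ hessY i (fun _ _ => 1) = 0 := by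
  rw [hessY_one_eq_comp, ← LinearMap.comp_assoc, divY_one_comp_coCurlY_one, LinearMap.zero_comp]

/-- ★ **`Δ_π(1) = Δ(1)` for ANY transporters ∕ `G′`** (the hypothesis-free form of n06-i's `B9Eq3132SectDLetters.deltaPiY_one`): at `U = 1` the
gauge projections drop out of (3.119) because `Δ(1)` kills gradients on both sides. [cite: Balaban1985BackgroundPropagators, (3.119)–(3.120) p.419] -/
theorem deltaPiY_one' (parS : SiteParY 𝔸 i) (Gp : SiteOpY 𝔸 i) : deltaPiY i parS Gp (fun _ _ => 1) = hessY i (fun _ _ => 1) := by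
  have hpi : hessY i (fun _ _ => 1) ∘ₗ gaugePiY i parS Gp (fun _ _ => 1) = hessY (𝔸 := 𝔸) i (fun _ _ => 1) := by
    simp only [gaugePiY, LinearMap.comp_sub, LinearMap.comp_id, ← LinearMap.comp_assoc, hessY_one_comp_gradY_one, LinearMap.zero_comp, sub_zero]
  rw [deltaPiY, hpi]
  simp only [gaugePiTY, LinearMap.sub_comp, LinearMap.id_comp, LinearMap.comp_assoc, divY_one_comp_hessY_one, LinearMap.comp_zero, sub_zero]

/-- ★ `Δ′_π(1) = 0` (print: `J = 0` at `U = 1`). [cite: Balaban1985BackgroundPropagators, (3.120) p.419] -/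
theorem deltaPiPrimeY_one (parS : SiteParY 𝔸 i) (Gp : SiteOpY 𝔸 i) : deltaPiPrimeY i parS Gp (fun _ _ => 1) = 0 := by
  rw [deltaPiPrimeY, deltaPiY_one', sub_self]

/-- `G̃⁻¹(1) = Δ_a(1)` for any transporters ∕ `G′` (hypothesis-free form of n06-i's `deltaPiAY_one`). [cite: Balaban1985BackgroundPropagators, (3.122) p.420, (3.26) p.395] -/
theorem deltaPiAY_one' (parS : SiteParY 𝔸 i) (parB : BondParY 𝔸 i) (Gp : SiteOpY 𝔸 i) :
    deltaPiAY i parS parB Gp (fun _ _ => 1) = deltaAY i parS parB Gp (fun _ _ => 1) := by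
  rw [deltaPiAY_eq_deltaAY_sub, deltaPiPrimeY_one, sub_zero]

/-- at `U = 1` a residual letter vanishing at `1` contributes nothing: `Δ⁽²⁾_π(1) = 0`. [cite: Balaban1985BackgroundPropagators, (3.134)–(3.135) p.422, bookkeeping] -/
theorem delta2PiY_one (parS : SiteParY 𝔸 i) (Gp : SiteOpY 𝔸 i) {Δ2 : BondOpY 𝔸 i} (hΔ : Δ2 (fun _ _ => 1) = 0) :
    delta2PiY i parS Gp Δ2 (fun _ _ => 1) = 0 := by
  rw [delta2PiY, hΔ, LinearMap.zero_comp, LinearMap.comp_zero]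

/-- at `U = 1`: `G₁(1)⁻¹ = Δ_a(1)`. [cite: Balaban1985BackgroundPropagators, (3.128) p.421, (3.26) p.395, bookkeeping] -/
theorem deltaOneY_one (parS : SiteParY 𝔸 i) (parB : BondParY 𝔸 i) (Gp : SiteOpY 𝔸 i) {Δ2 : BondOpY 𝔸 i} (hΔ : Δ2 (fun _ _ => 1) = 0) :
    deltaOneY i parS parB Gp Δ2 (fun _ _ => 1) = deltaAY i parS parB Gp (fun _ _ => 1) := by
  rw [deltaOneY, delta2PiY_one i parS Gp hΔ, sub_zero, deltaPiAY_one']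

/-- ★ `G₁(1) = G(1)` (`= G_D(1)`, n06-i's `GDY_one`). [cite: Balaban1985BackgroundPropagators, (3.128)–(3.129) p.421, Cor. 3.5 p.407, bookkeeping] -/
theorem G1Y_one (parS : SiteParY 𝔸 i) (parB : BondParY 𝔸 i) (Gp : SiteOpY 𝔸 i) {Δ2 : BondOpY 𝔸 i} (hΔ : Δ2 (fun _ _ => 1) = 0) :
    G1Y i parS parB Gp Δ2 (fun _ _ => 1) = GAY i parS parB Gp (fun _ _ => 1) := by
  show Ring.inverse _ = Ring.inverse _
  rw [deltaOneY_one i parS parB Gp hΔ]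

/-- ★ **THE `U = 1` CLAUSE for `G₁`**: `G₁(1)(J ⊗ E) = (Gop J) ⊗ E` — the lift of r03's `Gop = Δ_a⁻¹` of [4] (2.129).
[cite: Balaban1985BackgroundPropagators, Cor. 3.5 p.407 («for U = 1 these theorems are proved in [4]»), (3.129) p.421] -/
theorem G1Y_one_liftY {parS : SiteParY 𝔸 i} {parB : BondParY 𝔸 i} {Gp : SiteOpY 𝔸 i} {Δ2 : BondOpY 𝔸 i}
    (hparS : ∀ z w, parS (fun _ _ => 1) z w = 1) (hparB : ∀ s s', parB (fun _ _ => 1) s s' = 1)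
    (hGp : ∀ (f : SiteY i → ℝ) (E : 𝔸), Gp (fun _ _ => 1) (liftY f E) = liftY ((toKT i).G *ᵥ f) E) (hΔ : Δ2 (fun _ _ => 1) = 0)
    (J : FBondY i → ℝ) (E : 𝔸) :
    G1Y i parS parB Gp Δ2 (fun _ _ => 1) (liftY J E) = liftY (Gop i J) E := by
  rw [G1Y_one i parS parB Gp hΔ]
  exact GAY_one_liftY i hparS hparB hGp J E

/-- `G₁(1)` as an operator is the lift of `Gop`. [cite: Balaban1985BackgroundPropagators, Cor. 3.5 p.407, (3.129) p.421, bookkeeping] -/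
theorem G1Y_one_liftEndY {parS : SiteParY 𝔸 i} {parB : BondParY 𝔸 i} {Gp : SiteOpY 𝔸 i} {Δ2 : BondOpY 𝔸 i}
    (hparS : ∀ z w, parS (fun _ _ => 1) z w = 1) (hparB : ∀ s s', parB (fun _ _ => 1) s s' = 1)
    (hGp : ∀ (f : SiteY i → ℝ) (E : 𝔸), Gp (fun _ _ => 1) (liftY f E) = liftY ((toKT i).G *ᵥ f) E) (hΔ : Δ2 (fun _ _ => 1) = 0) :
    G1Y i parS parB Gp Δ2 (fun _ _ => 1) = liftEndY 𝔸 (Gop i) := by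
  rw [G1Y_one i parS parB Gp hΔ]
  exact GAY_one i hparS hparB hGp

/-- `G₁(1)⁻¹` is invertible. [cite: Balaban1985BackgroundPropagators, Thm 3.12 p.423 (U = 1 case = [4]), bookkeeping] -/
theorem isUnit_deltaOneY_one {parS : SiteParY 𝔸 i} {parB : BondParY 𝔸 i} {Gp : SiteOpY 𝔸 i} {Δ2 : BondOpY 𝔸 i}
    (hparS : ∀ z w, parS (fun _ _ => 1) z w = 1) (hparB : ∀ s s', parB (fun _ _ => 1) s s' = 1)
    (hGp : ∀ (f : SiteY i → ℝ) (E : 𝔸), Gp (fun _ _ => 1) (liftY f E) = liftY ((toKT i).G *ᵥ f) E) (hΔ : Δ2 (fun _ _ => 1) = 0) :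
    IsUnit (deltaOneY i parS parB Gp Δ2 (fun _ _ => 1)) := by
  rw [deltaOneY_one i parS parB Gp hΔ]
  exact isUnit_deltaAY_one i hparS hparB hGp

/-- `G(1) = G₀(1)` for any transporters ∕ `G′` (hypothesis-free form of n06-i's `GDY_one`). [cite: Balaban1985BackgroundPropagators, (3.122) p.420, (3.27) p.395, bookkeeping] -/
theorem GDY_one' (parS : SiteParY 𝔸 i) (parB : BondParY 𝔸 i) (Gp : SiteOpY 𝔸 i) :
    GDY i parS parB Gp (fun _ _ => 1) = GAY i parS parB Gp (fun _ _ => 1) := by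
  show Ring.inverse _ = Ring.inverse _
  rw [deltaPiAY_one']

/-- at `U = 1`: `QG₁Q*(1) = QGQ*(1)` (so n06-i's `QGQY_one_liftEndY ∕ isUnit_QGQY_one ∕ QGQinvY_one_liftEndY` transfer to the `G₁` letters).
[cite: Balaban1985BackgroundPropagators, (3.132) p.422, bookkeeping] -/
theorem QGQOfY_G1Y_one (parS : SiteParY 𝔸 i) (parB : BondParY 𝔸 i) (Gp : SiteOpY 𝔸 i) {Δ2 : BondOpY 𝔸 i} (hΔ : Δ2 (fun _ _ => 1) = 0) :
    QGQOfY i parB (G1Y i parS parB Gp Δ2) (fun _ _ => 1) = QGQY i parS parB Gp (fun _ _ => 1) := by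
  rw [QGQOfY, QGQY, G1Y_one i parS parB Gp hΔ, GDY_one']

/-- at `U = 1`: `(QG₁Q*)⁻¹(1) = (QGQ*)⁻¹(1)`. [cite: Balaban1985BackgroundPropagators, (3.132) p.422, bookkeeping] -/
theorem QG1QinvY_one (parS : SiteParY 𝔸 i) (parB : BondParY 𝔸 i) (Gp : SiteOpY 𝔸 i) {Δ2 : BondOpY 𝔸 i} (hΔ : Δ2 (fun _ _ => 1) = 0) :
    QG1QinvY i parS parB Gp Δ2 (fun _ _ => 1) = QGQinvY i parS parB Gp (fun _ _ => 1) := by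
  show Ring.inverse _ = Ring.inverse _
  rw [QGQOfY_G1Y_one i parS parB Gp hΔ]

/-- at `U = 1`: `H₁(1) = H(1)`. [cite: Balaban1985BackgroundPropagators, (3.129) p.421, (3.126) p.421, bookkeeping] -/
theorem H1Y_one (parS : SiteParY 𝔸 i) (parB : BondParY 𝔸 i) (Gp : SiteOpY 𝔸 i) {Δ2 : BondOpY 𝔸 i} (hΔ : Δ2 (fun _ _ => 1) = 0) :
    H1Y i parS parB Gp Δ2 (fun _ _ => 1) = HDY i parS parB Gp (fun _ _ => 1) := by
  rw [H1Y, HOfY, HDY, G1Y_one i parS parB Gp hΔ, GDY_one']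
  show _ ∘ₗ _ ∘ₗ QG1QinvY i parS parB Gp Δ2 (fun _ _ => 1) = _
  rw [QG1QinvY_one i parS parB Gp hΔ]

end AtOne

end Letters
/-! ## §5 Theorem 3.14's letter: `G(Ω, U) − G(Ω′, U)` for the two nested sequences of a member -/

section TwoSequences

variable (𝔸)

/-- def-Y's v2 letter `G(U) = Δ_a(U)⁻¹` (3.27) AT AN INDEX, over the record's taxicab transporters and its `G′` (`= (covLettersY_v2 𝔸 x).GA` at
`i = x.toKIdx`, `rfl`). [cite: Balaban1985BackgroundPropagators, (3.27) p.395, Thm 3.3 p.399] -/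
def GAv2Y (i : KIdx d ℓ hd hL b₀ b₁) : BondOpY 𝔸 i := GAY i (parSY i) (parBY i) (GpY i (parSY i))

/-- `(covLettersY_v2 𝔸 x).GA` is `GAv2Y` at the member's index. [cite: Balaban1985BackgroundPropagators, (3.27) p.395, bookkeeping] -/
theorem covLettersY_v2_GA_eq (x : MemberY d ℓ hd hL b₀ b₁ Mstar) : (covLettersY_v2 𝔸 x).GA = GAv2Y 𝔸 x.toKIdx := rfl

/-- `G(Ω′, U)`: the operator of Thm 3.3 constructed for the SECOND sequence `{Ω′_j}` of the member (index `x.snd`: same torus, `k`, `M`, units —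
its carriers are the member's, definitionally). [cite: Balaban1985BackgroundPropagators, Thm 3.14 pp.426–427 («we construct operators for both sequences»)] -/
def GAsndY (x : MemberY d ℓ hd hL b₀ b₁ Mstar) : BondOpY 𝔸 x.toKIdx := (GAv2Y 𝔸 x.snd : BondOpY 𝔸 x.snd)

/-- ★ **THEOREM 3.14's LETTER `G(Ω, U) − G(Ω′, U)`** for `G = Δ_a⁻¹` of Thm 3.3 — the `Kdiff` letter (read by `Thm314Printed` through Thm 3.3's four entries).
[cite: Balaban1985BackgroundPropagators, Thm 3.14 (3.154) pp.426–427] -/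
def KdiffY (x : MemberY d ℓ hd hL b₀ b₁ Mstar) : BondOpY 𝔸 x.toKIdx := fun U => GAv2Y 𝔸 x.toKIdx U - GAsndY 𝔸 x U

/-- at a DIAGONAL member (`{Ω′_j} = {Ω_j}`) the difference vanishes. [cite: Balaban1985BackgroundPropagators, Thm 3.14 pp.426–427, bookkeeping] -/
theorem KdiffY_diag (i : KIdx d ℓ hd hL b₀ b₁) (hcf : i.cf = (((ℓ + 1 : ℕ) : ℝ)) ^ i.k) (hM : Mstar ≤ (ℓ + 1) * i.Mh) :
    KdiffY 𝔸 (MemberY.diag (Mstar := Mstar) i hcf hM) = fun _ => 0 :=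
  funext fun _ => sub_self _

end TwoSequences

/-! ## §6 The residual letter `Δ⁽²⁾(U)`, the record update `CovLettersY.withDE` and def-Y's v3 family `= withSectD ∘ withDE ∘ v2` at a member -/

section Upgrade

variable (𝔸)

/-- **THE RESIDUAL LETTER OF SECT. D**: the bond-sector operator `Δ⁽²⁾(U)` of (3.134), `⟨A, Δ⁽²⁾A⟩ = 2⟨HC⁽²⁾(A), J⟩`, `J = D*η⁻²Im ∂U` (p. 419),
`C⁽²⁾` the quadratic term of [5] (1.36) — its lattice construction needs [5]'s `C⁽²⁾` and the field `J`, which are not objects of NODE 00's tree, so it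
is carried as a PARAMETER with its printed `U = 1` clause (`∂U = 1 ⇒ Im ∂U = 0 ⇒ J = 0 ⇒ Δ⁽²⁾(1) = 0`).
[cite: Balaban1985BackgroundPropagators, (3.134) p.422, (3.116)–(3.117) p.419 (J), p.391 (Im U(∂p))] -/
structure ResLettersY (x : MemberY d ℓ hd hL b₀ b₁ Mstar) where
  Δ2 : BondOpY 𝔸 x.toKIdx
  Δ2_one : Δ2 (fun _ _ => 1) = 0

/-- the flat residual letter `Δ⁽²⁾ := 0` (nonvacuity of `ResLettersY`; NOT the genuine (3.134) away from `U = 1`).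
[cite: Balaban1985BackgroundPropagators, (3.134) p.422, bookkeeping] -/
def resLettersY_flat (x : MemberY d ℓ hd hL b₀ b₁ Mstar) : ResLettersY 𝔸 x := ⟨fun _ => 0, rfl⟩

variable {x : MemberY d ℓ hd hL b₀ b₁ Mstar}

/-- **FILLING THE REMAINING D∕E LETTERS**: over the record's own `parS ∕ parB ∕ Gp` and the residual letter `Δ⁽²⁾`: `G₁` (3.128)∕(3.138), `H₁` (3.129),
`QG1Qinv := (QG₁Q*)⁻¹` (3.132), `GG := 𝔊 = 𝔓G₁` (3.153); and `Kdiff := GA − G(Ω′, ·)` (Thm 3.14) against a given second-sequence operator `GA'`.  The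
letters `GD ∕ H ∕ QGQinv` are NOT set here — they are n06-i's `withSectD` (ONE definition for rows 20∕26; v3 below is `withSectD ∘ withDE`); the slots
`P349`, `Ck` are NOT touched (file header (M8): their carriers in `CovLettersY` cannot hold the printed site-sector `P = I − R` (3.49) ∕ the unit-lattice
bond-sector `C^{(k)}(Λ)` (3.185)). [cite: Balaban1985BackgroundPropagators, (3.128)–(3.132) pp.421–422, (3.138) p.423, (3.153) p.426, Thm 3.14 pp.426–427] -/
def CovLettersY.withDE (𝔏 : CovLettersY 𝔸 x) (GA' : BondOpY 𝔸 x.toKIdx) (𝔯 : ResLettersY 𝔸 x) : CovLettersY 𝔸 x :=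
  { 𝔏 with
    G₁ := G1Y x.toKIdx 𝔏.parS 𝔏.parB 𝔏.Gp 𝔯.Δ2
    GG := GGY x.toKIdx 𝔏.parS 𝔏.parB 𝔏.Gp 𝔯.Δ2
    Kdiff := fun U => 𝔏.GA U - GA' U
    H₁ := H1Y x.toKIdx 𝔏.parS 𝔏.parB 𝔏.Gp 𝔯.Δ2
    QG1Qinv := QG1QinvY x.toKIdx 𝔏.parS 𝔏.parB 𝔏.Gp 𝔯.Δ2 }

variable {𝔸}
variable (𝔏 : CovLettersY 𝔸 x) (GA' : BondOpY 𝔸 x.toKIdx) (𝔯 : ResLettersY 𝔸 x)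

/-- the updated `G₁`. [cite: Balaban1985BackgroundPropagators, (3.129) p.421, bookkeeping] -/
theorem CovLettersY.withDE_G₁ : (𝔏.withDE 𝔸 GA' 𝔯).G₁ = G1Y x.toKIdx 𝔏.parS 𝔏.parB 𝔏.Gp 𝔯.Δ2 := rfl
/-- the updated `GG = 𝔊`. [cite: Balaban1985BackgroundPropagators, (3.153) p.426, bookkeeping] -/
theorem CovLettersY.withDE_GG : (𝔏.withDE 𝔸 GA' 𝔯).GG = GGY x.toKIdx 𝔏.parS 𝔏.parB 𝔏.Gp 𝔯.Δ2 := rfl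
/-- the updated `Kdiff = GA − G(Ω′, ·)`. [cite: Balaban1985BackgroundPropagators, Thm 3.14 pp.426–427, bookkeeping] -/
theorem CovLettersY.withDE_Kdiff : (𝔏.withDE 𝔸 GA' 𝔯).Kdiff = fun U => 𝔏.GA U - GA' U := rfl
/-- the updated `H₁`. [cite: Balaban1985BackgroundPropagators, (3.129) p.421, bookkeeping] -/
theorem CovLettersY.withDE_H₁ : (𝔏.withDE 𝔸 GA' 𝔯).H₁ = H1Y x.toKIdx 𝔏.parS 𝔏.parB 𝔏.Gp 𝔯.Δ2 := rfl
/-- the updated `QG1Qinv = (QG₁Q*)⁻¹`. [cite: Balaban1985BackgroundPropagators, (3.132) p.422, bookkeeping] -/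
theorem CovLettersY.withDE_QG1Qinv : (𝔏.withDE 𝔸 GA' 𝔯).QG1Qinv = QG1QinvY x.toKIdx 𝔏.parS 𝔏.parB 𝔏.Gp 𝔯.Δ2 := rfl
/-- the update keeps `GD` (set by `withSectD`). [cite: Balaban1985BackgroundPropagators, (3.122) p.420, bookkeeping] -/
theorem CovLettersY.withDE_GD : (𝔏.withDE 𝔸 GA' 𝔯).GD = 𝔏.GD := rfl
/-- the update keeps `H` (set by `withSectD`). [cite: Balaban1985BackgroundPropagators, (3.126) p.421, bookkeeping] -/
theorem CovLettersY.withDE_H : (𝔏.withDE 𝔸 GA' 𝔯).H = 𝔏.H := rfl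
/-- the update keeps `QGQinv` (set by `withSectD`). [cite: Balaban1985BackgroundPropagators, (3.132) p.422, bookkeeping] -/
theorem CovLettersY.withDE_QGQinv : (𝔏.withDE 𝔸 GA' 𝔯).QGQinv = 𝔏.QGQinv := rfl
/-- the update keeps `GA`. [cite: Balaban1985BackgroundPropagators, (3.27) p.395, bookkeeping] -/
theorem CovLettersY.withDE_GA : (𝔏.withDE 𝔸 GA' 𝔯).GA = 𝔏.GA := rfl
/-- the update keeps `C`. [cite: Balaban1985BackgroundPropagators, (3.48) p.398, bookkeeping] -/
theorem CovLettersY.withDE_C : (𝔏.withDE 𝔸 GA' 𝔯).C = 𝔏.C := rfl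
/-- the update keeps `G′`. [cite: Balaban1985BackgroundPropagators, (3.25) p.395, bookkeeping] -/
theorem CovLettersY.withDE_Gp : (𝔏.withDE 𝔸 GA' 𝔯).Gp = 𝔏.Gp := rfl
/-- the update keeps the site transporter. [cite: Balaban1985BackgroundPropagators, (3.40) p.397, bookkeeping] -/
theorem CovLettersY.withDE_parS : (𝔏.withDE 𝔸 GA' 𝔯).parS = 𝔏.parS := rfl
/-- the update keeps the bond transporter. [cite: Balaban1985BackgroundPropagators, (3.40) p.397, bookkeeping] -/
theorem CovLettersY.withDE_parB : (𝔏.withDE 𝔸 GA' 𝔯).parB = 𝔏.parB := rfl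
/-- the update keeps the (untouched, flat-at-the-record) `P349` slot. [cite: Balaban1985BackgroundPropagators, (3.49) p.399, bookkeeping] -/
theorem CovLettersY.withDE_P349 : (𝔏.withDE 𝔸 GA' 𝔯).P349 = 𝔏.P349 := rfl
/-- the update keeps the (untouched, flat-at-the-record) `Ck` slot. [cite: Balaban1985BackgroundPropagators, (3.187) p.432, bookkeeping] -/
theorem CovLettersY.withDE_Ck : (𝔏.withDE 𝔸 GA' 𝔯).Ck = 𝔏.Ck := rfl

/-- `withSectD` after `withDE` reads the SAME `G₁ ∕ QG1Qinv ∕ H₁ ∕ GG ∕ Kdiff` (n06-i's update touches only `GD ∕ QGQinv ∕ H`).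
[cite: Balaban1985BackgroundPropagators, (3.122)–(3.132) pp.420–422, bookkeeping] -/
theorem withSectD_withDE_G₁ : (withSectD 𝔸 (𝔏.withDE 𝔸 GA' 𝔯)).G₁ = G1Y x.toKIdx 𝔏.parS 𝔏.parB 𝔏.Gp 𝔯.Δ2 ∧
    (withSectD 𝔸 (𝔏.withDE 𝔸 GA' 𝔯)).QG1Qinv = QG1QinvY x.toKIdx 𝔏.parS 𝔏.parB 𝔏.Gp 𝔯.Δ2 ∧
    (withSectD 𝔸 (𝔏.withDE 𝔸 GA' 𝔯)).H₁ = H1Y x.toKIdx 𝔏.parS 𝔏.parB 𝔏.Gp 𝔯.Δ2 ∧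
    (withSectD 𝔸 (𝔏.withDE 𝔸 GA' 𝔯)).GG = GGY x.toKIdx 𝔏.parS 𝔏.parB 𝔏.Gp 𝔯.Δ2 ∧
    (withSectD 𝔸 (𝔏.withDE 𝔸 GA' 𝔯)).Kdiff = (fun U => 𝔏.GA U - GA' U) := ⟨rfl, rfl, rfl, rfl, rfl⟩

/-- … and n06-i's three Sect. D letters over the SAME `parS ∕ parB ∕ Gp` (so `withSectD ∘ withDE` and `withDE ∘ withSectD` agree, `rfl`).
[cite: Balaban1985BackgroundPropagators, (3.122)–(3.126) pp.420–421, bookkeeping] -/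
theorem withSectD_withDE_comm : withSectD 𝔸 (𝔏.withDE 𝔸 GA' 𝔯) = (withSectD 𝔸 𝔏).withDE 𝔸 GA' 𝔯 := rfl

/-- at `U = 1` the updated `G₁` acts on product-form arguments as the lift of `Gop` (the record's own clauses + `Δ⁽²⁾(1) = 0`).
[cite: Balaban1985BackgroundPropagators, Cor. 3.5 p.407, (3.129) p.421] -/
theorem CovLettersY.withDE_G₁_one (J : FBondY x.toKIdx → ℝ) (E : 𝔸) :
    (𝔏.withDE 𝔸 GA' 𝔯).G₁ (fun _ _ => 1) (liftY J E) = liftY (Gop x.toKIdx J) E :=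
  G1Y_one_liftY x.toKIdx 𝔏.parS_one 𝔏.parB_one 𝔏.Gp_one 𝔯.Δ2_one J E

variable (𝔸) (x)

/-- ★ **def-Y's v3 LETTER FAMILY AT A MEMBER**: v2 (`covLettersY_v2`: taxicab transporters, `G′ = Δ′_a⁻¹`, `G = Δ_a⁻¹`, `C = (Q′G′²Q′*)⁻¹`) with the Sect. D
letters made genuine (`GD, H, QGQinv`; `G₁, H₁, QG1Qinv, GG` over the residual `Δ⁽²⁾`) and `Kdiff = G(Ω, ·) − G(Ω′, ·)`; `P349`, `Ck` stay the flat `0` of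
`covLettersY_flat`: **v3 = `withSectD ∘ withDE ∘ v2`** (n06-i's `covLettersY_v2D = withSectD ∘ v2` with the five D∕E letters filled first).
[cite: Balaban1985BackgroundPropagators, (3.122)–(3.132) pp.420–422, (3.138) p.423, (3.153) p.426, Thm 3.14 pp.426–427] -/
def covLettersY_v3 (𝔯 : ResLettersY 𝔸 x) : CovLettersY 𝔸 x := withSectD 𝔸 ((covLettersY_v2 𝔸 x).withDE 𝔸 (GAsndY 𝔸 x) 𝔯)

variable {x}
variable (𝔯 : ResLettersY 𝔸 x)

/-- its `GD` is Sect. D's `G` over the genuine transporters and `G′`. [cite: Balaban1985BackgroundPropagators, (3.122) p.420, bookkeeping] -/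
theorem covLettersY_v3_GD : (covLettersY_v3 𝔸 x 𝔯).GD = GDY x.toKIdx (parSY x.toKIdx) (parBY x.toKIdx) (GpY x.toKIdx (parSY x.toKIdx)) := rfl
/-- its `H`. [cite: Balaban1985BackgroundPropagators, (3.126) p.421, bookkeeping] -/
theorem covLettersY_v3_H : (covLettersY_v3 𝔸 x 𝔯).H = HDY x.toKIdx (parSY x.toKIdx) (parBY x.toKIdx) (GpY x.toKIdx (parSY x.toKIdx)) := rfl
/-- its `QGQinv`. [cite: Balaban1985BackgroundPropagators, (3.132) p.422, bookkeeping] -/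
theorem covLettersY_v3_QGQinv :
    (covLettersY_v3 𝔸 x 𝔯).QGQinv = QGQinvY x.toKIdx (parSY x.toKIdx) (parBY x.toKIdx) (GpY x.toKIdx (parSY x.toKIdx)) := rfl
/-- its `G₁`. [cite: Balaban1985BackgroundPropagators, (3.129) p.421, bookkeeping] -/
theorem covLettersY_v3_G₁ :
    (covLettersY_v3 𝔸 x 𝔯).G₁ = G1Y x.toKIdx (parSY x.toKIdx) (parBY x.toKIdx) (GpY x.toKIdx (parSY x.toKIdx)) 𝔯.Δ2 := rfl
/-- its `H₁`. [cite: Balaban1985BackgroundPropagators, (3.129) p.421, bookkeeping] -/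
theorem covLettersY_v3_H₁ :
    (covLettersY_v3 𝔸 x 𝔯).H₁ = H1Y x.toKIdx (parSY x.toKIdx) (parBY x.toKIdx) (GpY x.toKIdx (parSY x.toKIdx)) 𝔯.Δ2 := rfl
/-- its `QG1Qinv`. [cite: Balaban1985BackgroundPropagators, (3.132) p.422, bookkeeping] -/
theorem covLettersY_v3_QG1Qinv :
    (covLettersY_v3 𝔸 x 𝔯).QG1Qinv = QG1QinvY x.toKIdx (parSY x.toKIdx) (parBY x.toKIdx) (GpY x.toKIdx (parSY x.toKIdx)) 𝔯.Δ2 := rfl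
/-- its `GG = 𝔊`. [cite: Balaban1985BackgroundPropagators, (3.153) p.426, bookkeeping] -/
theorem covLettersY_v3_GG :
    (covLettersY_v3 𝔸 x 𝔯).GG = GGY x.toKIdx (parSY x.toKIdx) (parBY x.toKIdx) (GpY x.toKIdx (parSY x.toKIdx)) 𝔯.Δ2 := rfl
/-- ★ its `Kdiff` IS Theorem 3.14's `G(Ω, U) − G(Ω′, U)`. [cite: Balaban1985BackgroundPropagators, Thm 3.14 pp.426–427, bookkeeping] -/
theorem covLettersY_v3_Kdiff : (covLettersY_v3 𝔸 x 𝔯).Kdiff = KdiffY 𝔸 x := rfl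
/-- its `GA` is v2's genuine `Δ_a⁻¹`. [cite: Balaban1985BackgroundPropagators, (3.27) p.395, bookkeeping] -/
theorem covLettersY_v3_GA : (covLettersY_v3 𝔸 x 𝔯).GA = (covLettersY_v2 𝔸 x).GA := rfl
/-- its `C` is v2's genuine `(Q′G′²Q′*)⁻¹`. [cite: Balaban1985BackgroundPropagators, (3.48) p.398, bookkeeping] -/
theorem covLettersY_v3_C : (covLettersY_v3 𝔸 x 𝔯).C = (covLettersY_v2 𝔸 x).C := rfl
/-- its `G′` is v2's `GpY`. [cite: Balaban1985BackgroundPropagators, (3.25) p.395, bookkeeping] -/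
theorem covLettersY_v3_Gp : (covLettersY_v3 𝔸 x 𝔯).Gp = GpY x.toKIdx (parSY x.toKIdx) := rfl
/-- its transporters are the taxicab ones. [cite: Balaban1985BackgroundPropagators, (3.40) p.397, bookkeeping] -/
theorem covLettersY_v3_parS : (covLettersY_v3 𝔸 x 𝔯).parS = parSY x.toKIdx := rfl
/-- its bond transporters are the taxicab ones. [cite: Balaban1985BackgroundPropagators, (3.40) p.397, bookkeeping] -/
theorem covLettersY_v3_parB : (covLettersY_v3 𝔸 x 𝔯).parB = parBY x.toKIdx := rfl
/-- LOCATED: its `P349` slot is the flat `0` (the printed `P = I − R` (3.49) is the SITE-sector `P349Y`, which the bond-sector slot cannot hold).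
[cite: Balaban1985BackgroundPropagators, (3.49) p.399, bookkeeping] -/
theorem covLettersY_v3_P349 : (covLettersY_v3 𝔸 x 𝔯).P349 = fun _ => 0 := rfl
/-- LOCATED: its `Ck` slot is the flat `0` (the printed `C^{(k)}(Λ)` (3.185) acts on unit-lattice BOND functions, which the block-sector slot cannot hold).
[cite: Balaban1985BackgroundPropagators, (3.185)–(3.187) p.432, bookkeeping] -/
theorem covLettersY_v3_Ck : (covLettersY_v3 𝔸 x 𝔯).Ck = fun _ => 0 := rfl

/-- ★ **v3 AGREES WITH n06-i's `covLettersY_v2D` ON `GD ∕ QGQinv ∕ H`** (and on every Sect. B letter): rows 20 ∕ 26(first half) of the N06 knit read ONE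
definition at both families. [cite: Balaban1985BackgroundPropagators, (3.122)–(3.132) pp.420–422, bookkeeping] -/
theorem covLettersY_v3_sectD_eq_v2D : (covLettersY_v3 𝔸 x 𝔯).GD = (covLettersY_v2D 𝔸 x).GD ∧ (covLettersY_v3 𝔸 x 𝔯).QGQinv = (covLettersY_v2D 𝔸 x).QGQinv ∧
    (covLettersY_v3 𝔸 x 𝔯).H = (covLettersY_v2D 𝔸 x).H ∧ (covLettersY_v3 𝔸 x 𝔯).GA = (covLettersY_v2D 𝔸 x).GA ∧
    (covLettersY_v3 𝔸 x 𝔯).C = (covLettersY_v2D 𝔸 x).C ∧ (covLettersY_v3 𝔸 x 𝔯).Gp = (covLettersY_v2D 𝔸 x).Gp := ⟨rfl, rfl, rfl, rfl, rfl, rfl⟩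

/-- v3 IS `withSectD` of a letter family (the syntactic shape n06-i's `s3132_withSectD` quantifies over: `𝔏 := (covLettersY_v2 𝔸 x).withDE …`).
[cite: Balaban1985BackgroundPropagators, (3.132) p.422, bookkeeping] -/
theorem covLettersY_v3_eq_withSectD : covLettersY_v3 𝔸 x 𝔯 = withSectD 𝔸 ((covLettersY_v2 𝔸 x).withDE 𝔸 (GAsndY 𝔸 x) 𝔯) := rfl

/-- the two `(3.132)` letters of v3 are `Ring.inverse` of NAMED operators — the `hT ∕ hT₁ := fun _ _ => rfl` shape of n06-i g4's
`B9Eq3132RingInverseReading.stmt3132Printed_opsYOfLetters_of_ringInverse` (row 26 from four estimates, none vacuous).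
[cite: Balaban1985BackgroundPropagators, (3.132) p.422, bookkeeping] -/
theorem covLettersY_v3_QGQinv_QG1Qinv_ringInverse (U : CfgY 𝔸 x.toKIdx) :
    (covLettersY_v3 𝔸 x 𝔯).QGQinv U = Ring.inverse (QGQY x.toKIdx (parSY x.toKIdx) (parBY x.toKIdx) (GpY x.toKIdx (parSY x.toKIdx)) U) ∧
    (covLettersY_v3 𝔸 x 𝔯).QG1Qinv U =
      Ring.inverse (QGQOfY x.toKIdx (parBY x.toKIdx) (G1Y x.toKIdx (parSY x.toKIdx) (parBY x.toKIdx) (GpY x.toKIdx (parSY x.toKIdx)) 𝔯.Δ2) U) :=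
  ⟨rfl, rfl⟩

end Upgrade

/-! ## §7 The v3 letters and the `OpsY` instance OF RECORD with the Sect. D letters -/

section Record

open scoped Matrix.Norms.L2Operator

/-- the residual letters of a Stage 3′(Y) family: one `Δ⁽²⁾` per member, `𝔸 = M_N(ℂ)`. [cite: Balaban1985BackgroundPropagators, (3.134) p.422] -/
abbrev ResY (N : ℕ) (θ : Stage3Params) (Mstar : ℕ) : Type :=
  ∀ x : MemberY θ.d₆ θ.ℓ₆ θ.hd' θ.hL' θ.b₀ θ.b₁ Mstar, ResLettersY (Matrix (Fin N) (Fin N) ℂ) x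

/-- the flat residual family (nonvacuity). [cite: Balaban1985BackgroundPropagators, (3.134) p.422, bookkeeping] -/
def resY_flat (N : ℕ) (θ : Stage3Params) (Mstar : ℕ) : ResY N θ Mstar := fun x => resLettersY_flat (Matrix (Fin N) (Fin N) ℂ) x

/-- ★ **THE v3 LETTERS OF RECORD**: def-Y's v3 family at every member of Stage 3′(Y), over a residual family `𝔯`.
[cite: Balaban1985BackgroundPropagators, (3.25)–(3.27) p.395, (3.48) p.398, (3.122)–(3.132) pp.420–422, (3.153) p.426, Thm 3.14 pp.426–427] -/
def lettersYOfRecordDE (N : ℕ) (θ : Stage3Params) (Mstar : ℕ) (𝔯 : ResY N θ Mstar) : LettersY N θ Mstar :=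
  fun x => covLettersY_v3 (Matrix (Fin N) (Fin N) ℂ) x (𝔯 x)

/-- the letters of record with the five D∕E letters filled but `GD ∕ QGQinv ∕ H` still v2's (flat) — the family `𝔏` with `lettersYOfRecordDE = fun x =>
withSectD _ (𝔏 x)` (`lettersYOfRecordDE_eq_withSectD`), i.e. the argument at which n06-i's `s3132_withSectD` yields row 26 at the v3 record.
[cite: Balaban1985BackgroundPropagators, (3.128)–(3.132) pp.421–422, bookkeeping] -/
def lettersYResOfRecord (N : ℕ) (θ : Stage3Params) (Mstar : ℕ) (𝔯 : ResY N θ Mstar) : LettersY N θ Mstar :=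
  fun x => (lettersYOfRecord N θ Mstar x).withDE (Matrix (Fin N) (Fin N) ℂ) (GAsndY (Matrix (Fin N) (Fin N) ℂ) x) (𝔯 x)

/-- ★ `lettersYOfRecordDE 𝔯 = fun x => withSectD _ (lettersYResOfRecord 𝔯 x)` (`rfl`). [cite: Balaban1985BackgroundPropagators, (3.122)–(3.132) pp.420–422, bookkeeping] -/
theorem lettersYOfRecordDE_eq_withSectD (N : ℕ) (θ : Stage3Params) (Mstar : ℕ) (𝔯 : ResY N θ Mstar) :
    lettersYOfRecordDE N θ Mstar 𝔯 = fun x => withSectD (Matrix (Fin N) (Fin N) ℂ) (lettersYResOfRecord N θ Mstar 𝔯 x) := rfl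

/-- ★ **THE `OpsY` INSTANCE OF RECORD WITH THE SECT. D LETTERS**: the SAME constructor `opsYOfLetters` at the v3 letters (so every N06 statement at
generic letters `𝔏` instantiates at `𝔏 := lettersYOfRecordDE N θ M⋆ 𝔯`); `𝔈` the predicate ∕ expansion letters, `𝔯` the residual `Δ⁽²⁾` family.
[cite: Balaban1985BackgroundPropagators, Thms 3.1–3.15 pp.397–432] -/
def opsYOfRecordDE (N : ℕ) (θ : Stage3Params) (Mstar : ℕ) (𝔯 : ResY N θ Mstar) (𝔈 : ExpsY N θ Mstar) : OpsY N θ Mstar :=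
  opsYOfLetters N θ Mstar (lettersYOfRecordDE N θ Mstar 𝔯) 𝔈

/-- the instance, unfolded. [cite: Balaban1985BackgroundPropagators, Thms 3.1–3.15 pp.397–432, bookkeeping] -/
theorem opsYOfRecordDE_eq (N : ℕ) (θ : Stage3Params) (Mstar : ℕ) (𝔯 : ResY N θ Mstar) (𝔈 : ExpsY N θ Mstar) :
    opsYOfRecordDE N θ Mstar 𝔯 𝔈 = opsYOfLetters N θ Mstar (lettersYOfRecordDE N θ Mstar 𝔯) 𝔈 := rfl

/-- the v3 letters of record at a member are the v3 family. [cite: Balaban1985BackgroundPropagators, (3.122)–(3.132) pp.420–422, bookkeeping] -/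
theorem lettersYOfRecordDE_apply (N : ℕ) (θ : Stage3Params) (Mstar : ℕ) (𝔯 : ResY N θ Mstar) (x : MemberY θ.d₆ θ.ℓ₆ θ.hd' θ.hL' θ.b₀ θ.b₁ Mstar) :
    lettersYOfRecordDE N θ Mstar 𝔯 x = covLettersY_v3 (Matrix (Fin N) (Fin N) ℂ) x (𝔯 x) := rfl

/-- the v3 letters of record EXTEND the letters of record: same `parS, parB, Gp, GA, C` (so everything proved about `lettersYOfRecord`'s Sect. B
letters — rows 1–13′, the gauge covariance of `OpsYGauge` — is inherited verbatim). [cite: Balaban1985BackgroundPropagators, (3.25)–(3.27) p.395, (3.48) p.398, bookkeeping] -/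
theorem lettersYOfRecordDE_GA (N : ℕ) (θ : Stage3Params) (Mstar : ℕ) (𝔯 : ResY N θ Mstar) (x : MemberY θ.d₆ θ.ℓ₆ θ.hd' θ.hL' θ.b₀ θ.b₁ Mstar) :
    (lettersYOfRecordDE N θ Mstar 𝔯 x).GA = (lettersYOfRecord N θ Mstar x).GA ∧ (lettersYOfRecordDE N θ Mstar 𝔯 x).C = (lettersYOfRecord N θ Mstar x).C ∧
      (lettersYOfRecordDE N θ Mstar 𝔯 x).Gp = (lettersYOfRecord N θ Mstar x).Gp ∧
      (lettersYOfRecordDE N θ Mstar 𝔯 x).parS = (lettersYOfRecord N θ Mstar x).parS ∧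
      (lettersYOfRecordDE N θ Mstar 𝔯 x).parB = (lettersYOfRecord N θ Mstar x).parB :=
  ⟨rfl, rfl, rfl, rfl, rfl⟩

/-- the v3 letters of record AGREE with n06-i's `lettersYSectD` on `GD ∕ QGQinv ∕ H` (rows 20 ∕ 21(H-half) ∕ 26(first half) read one definition).
[cite: Balaban1985BackgroundPropagators, (3.122)–(3.132) pp.420–422, bookkeeping] -/
theorem lettersYOfRecordDE_sectD (N : ℕ) (θ : Stage3Params) (Mstar : ℕ) (𝔯 : ResY N θ Mstar) (x : MemberY θ.d₆ θ.ℓ₆ θ.hd' θ.hL' θ.b₀ θ.b₁ Mstar) :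
    (lettersYOfRecordDE N θ Mstar 𝔯 x).GD = (lettersYSectD N θ Mstar x).GD ∧ (lettersYOfRecordDE N θ Mstar 𝔯 x).QGQinv = (lettersYSectD N θ Mstar x).QGQinv ∧
      (lettersYOfRecordDE N θ Mstar 𝔯 x).H = (lettersYSectD N θ Mstar x).H := ⟨rfl, rfl, rfl⟩

/-- the new letters of the v3 record, by name. [cite: Balaban1985BackgroundPropagators, (3.128)–(3.132) pp.421–422, (3.153) p.426, bookkeeping] -/
theorem lettersYOfRecordDE_G₁ (N : ℕ) (θ : Stage3Params) (Mstar : ℕ) (𝔯 : ResY N θ Mstar) (x : MemberY θ.d₆ θ.ℓ₆ θ.hd' θ.hL' θ.b₀ θ.b₁ Mstar) :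
    (lettersYOfRecordDE N θ Mstar 𝔯 x).G₁ = G1Y x.toKIdx (parSY x.toKIdx) (parBY x.toKIdx) (GpY x.toKIdx (parSY x.toKIdx)) (𝔯 x).Δ2 ∧
      (lettersYOfRecordDE N θ Mstar 𝔯 x).QG1Qinv = QG1QinvY x.toKIdx (parSY x.toKIdx) (parBY x.toKIdx) (GpY x.toKIdx (parSY x.toKIdx)) (𝔯 x).Δ2 ∧
      (lettersYOfRecordDE N θ Mstar 𝔯 x).H₁ = H1Y x.toKIdx (parSY x.toKIdx) (parBY x.toKIdx) (GpY x.toKIdx (parSY x.toKIdx)) (𝔯 x).Δ2 ∧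
      (lettersYOfRecordDE N θ Mstar 𝔯 x).GG = GGY x.toKIdx (parSY x.toKIdx) (parBY x.toKIdx) (GpY x.toKIdx (parSY x.toKIdx)) (𝔯 x).Δ2 :=
  ⟨rfl, rfl, rfl, rfl⟩

/-- ★ at `U = 1` the v3 record's `G₁` acts on product-form arguments as the lift of `Gop` — the `U = 1` clause shape of `CovLettersY.GA_one`, now for `G₁`.
[cite: Balaban1985BackgroundPropagators, Cor. 3.5 p.407, (3.129) p.421] -/
theorem lettersYOfRecordDE_G₁_one (N : ℕ) (θ : Stage3Params) (Mstar : ℕ) (𝔯 : ResY N θ Mstar) (x : MemberY θ.d₆ θ.ℓ₆ θ.hd' θ.hL' θ.b₀ θ.b₁ Mstar)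
    (J : FBondY x.toKIdx → ℝ) (E : Matrix (Fin N) (Fin N) ℂ) :
    (lettersYOfRecordDE N θ Mstar 𝔯 x).G₁ (fun _ _ => 1) (liftY J E) = liftY (Gop x.toKIdx J) E :=
  G1Y_one_liftY x.toKIdx (lettersYOfRecord N θ Mstar x).parS_one (lettersYOfRecord N θ Mstar x).parB_one (lettersYOfRecord N θ Mstar x).Gp_one (𝔯 x).Δ2_one J E

/-- ★ at the v3 record `Kdiff` IS `G(Ω, U) − G(Ω′, U)` (row 22 of the N06 table reads a genuine letter). [cite: Balaban1985BackgroundPropagators, Thm 3.14 pp.426–427, bookkeeping] -/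
theorem lettersYOfRecordDE_Kdiff (N : ℕ) (θ : Stage3Params) (Mstar : ℕ) (𝔯 : ResY N θ Mstar) (x : MemberY θ.d₆ θ.ℓ₆ θ.hd' θ.hL' θ.b₀ θ.b₁ Mstar) :
    (lettersYOfRecordDE N θ Mstar 𝔯 x).Kdiff = KdiffY (Matrix (Fin N) (Fin N) ℂ) x := rfl

/-- LOCATED: at the v3 record the `P349` and `Ck` slots are still the flat `0` (rows 23–25 of the N06 table stay vacuous through THIS interface).
[cite: Balaban1985BackgroundPropagators, (3.49) p.399, (3.187) p.432, bookkeeping] -/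
theorem lettersYOfRecordDE_P349_Ck (N : ℕ) (θ : Stage3Params) (Mstar : ℕ) (𝔯 : ResY N θ Mstar) (x : MemberY θ.d₆ θ.ℓ₆ θ.hd' θ.hL' θ.b₀ θ.b₁ Mstar) :
    (lettersYOfRecordDE N θ Mstar 𝔯 x).P349 = (fun _ => 0) ∧ (lettersYOfRecordDE N θ Mstar 𝔯 x).Ck = (fun _ => 0) := ⟨rfl, rfl⟩

/-- the [B9] bundle of record at the v3 instance. [cite: Balaban1985BackgroundPropagators, Thms 3.1–3.15 pp.397–432, bookkeeping] -/
theorem Y9OfRecord_opsYOfRecordDE (N : ℕ) (θ : Stage3Params) (Mstar : ℕ) (𝔯 : ResY N θ Mstar) (𝔈 : ExpsY N θ Mstar) :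
    Y9OfRecord N θ Mstar (opsYOfRecordDE N θ Mstar 𝔯 𝔈) =
      carriersY θ.d₆ θ.ℓ₆ θ.hd' θ.hL' θ.b₀ θ.b₁ Mstar (Matrix (Fin N) (Fin N) ℂ) (specialUnitaryUnits (Fin N)) (opsYOfRecordDE N θ Mstar 𝔯 𝔈) := rfl

end Record

/-! ## §G (3.33)–(3.34) FOR THE SECT. D LETTERS: every letter of this file and of `B9Eq3132SectDLetters` is GAUGE COVARIANT, `L(U^u)R(u) = R(u)L(U)` -/

section SectDCov

variable (i : KIdx d ℓ hd hL b₀ b₁) (g : GaugeY 𝔸 i) (U : CfgY 𝔸 i)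
variable {parS : SiteParY 𝔸 i} {parB : BondParY 𝔸 i} {Gp : SiteOpY 𝔸 i}

/-- a bond-sector letter `G(U)` is COVARIANT: `G(U^u)R(u) = R(u)G(U)` for every gauge function `u` (the shape of (3.34)).
[cite: Balaban1985BackgroundPropagators, (3.34) p.396] -/
def IsCovBondOpY (G : BondOpY 𝔸 i) : Prop :=
  ∀ (g : GaugeY 𝔸 i) (U : CfgY 𝔸 i), Intw (conjY (gBondY i g)) (conjY (gBondY i g)) (G U) (G (gaugeY i g U))

variable {i} in
/-- the zero letter is covariant (the flat residual `Δ⁽²⁾ := 0`). [cite: Balaban1985BackgroundPropagators, (3.34) p.396, bookkeeping] -/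
theorem isCovBondOpY_zero : IsCovBondOpY i (fun _ => (0 : (FBondY i → 𝔸) →ₗ[ℂ] (FBondY i → 𝔸))) := fun _ _ => Intw.zero

variable {i} in
/-- `G = Δ_a⁻¹` (3.27) is covariant (FILE 6's `GAY_cov`, packaged). [cite: Balaban1985BackgroundPropagators, (3.34) p.396] -/
theorem GAY_isCovBondOpY (hS : IsGaugeLawS i parS) (hB : IsGaugeLawB i parB) (hGp : IsCovSiteOpY i Gp) :
    IsCovBondOpY i (GAY i parS parB Gp) := fun _ _ => GAY_cov hS hB hGp

variable {i g U}

/-- ★ **`π = 1 − DG′RD*` is covariant** («the expression A − DG′RD*A has this invariance property», p.419). [cite: Balaban1985BackgroundPropagators, (3.119) p.419, (3.33) p.396] -/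
theorem gaugePiY_cov (hS : IsGaugeLawS i parS) (hGp : IsCovSiteOpY i Gp) :
    Intw (conjY (gBondY i g)) (conjY (gBondY i g)) (gaugePiY i parS Gp U) (gaugePiY i parS Gp (gaugeY i g U)) :=
  Intw.id.sub ((gradY_cov i g U).comp ((hGp g U).comp ((RY_cov hS hGp).comp (divY_cov i g U))))

/-- `π† = 1 − DRG′D*` is covariant. [cite: Balaban1985BackgroundPropagators, (3.119) p.419, (3.33) p.396] -/
theorem gaugePiTY_cov (hS : IsGaugeLawS i parS) (hGp : IsCovSiteOpY i Gp) :
    Intw (conjY (gBondY i g)) (conjY (gBondY i g)) (gaugePiTY i parS Gp U) (gaugePiTY i parS Gp (gaugeY i g U)) :=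
  Intw.id.sub ((gradY_cov i g U).comp ((RY_cov hS hGp).comp ((hGp g U).comp (divY_cov i g U))))

/-- ★ **`Δ_π(U^u)R(u) = R(u)Δ_π(U)`** (3.119) («The quadratic form is invariant with respect to gauge transformations», p.419; here: covariant under
`R(u)`, as (3.34) for `Δ_a`). [cite: Balaban1985BackgroundPropagators, (3.119) p.419, (3.34) p.396] -/
theorem deltaPiY_cov (hS : IsGaugeLawS i parS) (hGp : IsCovSiteOpY i Gp) :
    Intw (conjY (gBondY i g)) (conjY (gBondY i g)) (deltaPiY i parS Gp U) (deltaPiY i parS Gp (gaugeY i g U)) :=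
  (gaugePiTY_cov hS hGp).comp ((hessY_cov i g U).comp (gaugePiY_cov hS hGp))

/-- `Δ′_π` (3.120) is covariant. [cite: Balaban1985BackgroundPropagators, (3.120) p.419, (3.34) p.396] -/
theorem deltaPiPrimeY_cov (hS : IsGaugeLawS i parS) (hGp : IsCovSiteOpY i Gp) :
    Intw (conjY (gBondY i g)) (conjY (gBondY i g)) (deltaPiPrimeY i parS Gp U) (deltaPiPrimeY i parS Gp (gaugeY i g U)) :=
  (hessY_cov i g U).sub (deltaPiY_cov hS hGp)

/-- ★ `G̃⁻¹ = Δ_π + DRD* + Q*aQ` (3.122) is covariant. [cite: Balaban1985BackgroundPropagators, (3.122) p.420, (3.34) p.396] -/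
theorem deltaPiAY_cov (hS : IsGaugeLawS i parS) (hB : IsGaugeLawB i parB) (hGp : IsCovSiteOpY i Gp) :
    Intw (conjY (gBondY i g)) (conjY (gBondY i g)) (deltaPiAY i parS parB Gp U) (deltaPiAY i parS parB Gp (gaugeY i g U)) :=
  ((deltaPiY_cov hS hGp).add ((gradY_cov i g U).comp ((RY_cov hS hGp).comp (divY_cov i g U)))).add
    ((QsY_cov g U hB).comp ((aY_cov i g).comp (QY_cov g U hB)))

/-- ★★ **SECT. D's `G(U^u)R(u) = R(u)G(U)`** for `G = G̃ = (Δ_π + DRD* + Q*aQ)⁻¹` (3.122) — (3.34) for the Sect. D operator.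
[cite: Balaban1985BackgroundPropagators, (3.122) p.420, (3.34) p.396] -/
theorem GDY_cov (hS : IsGaugeLawS i parS) (hB : IsGaugeLawB i parB) (hGp : IsCovSiteOpY i Gp) :
    Intw (conjY (gBondY i g)) (conjY (gBondY i g)) (GDY i parS parB Gp U) (GDY i parS parB Gp (gaugeY i g U)) :=
  (deltaPiAY_cov hS hB hGp).ringInverse (isUnit_conjY _)

/-- Sect. D's `G` is a covariant bond-sector letter. [cite: Balaban1985BackgroundPropagators, (3.122) p.420, (3.34) p.396] -/
theorem GDY_isCovBondOpY (hS : IsGaugeLawS i parS) (hB : IsGaugeLawB i parB) (hGp : IsCovSiteOpY i Gp) :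
    IsCovBondOpY i (GDY i parS parB Gp) := fun _ _ => GDY_cov hS hB hGp

/-- `QGQ*` is covariant on coarse-bond functions, for any covariant `G`. [cite: Balaban1985BackgroundPropagators, (3.123) p.420, (3.32)–(3.34) pp.395–396] -/
theorem QGQOfY_cov {G : BondOpY 𝔸 i} (hB : IsGaugeLawB i parB) (hG : IsCovBondOpY i G) :
    Intw (conjY (gIBondY i g)) (conjY (gIBondY i g)) (QGQOfY i parB G U) (QGQOfY i parB G (gaugeY i g U)) :=
  (QY_cov g U hB).comp ((hG g U).comp (QsY_cov g U hB))

/-- ★ `(QGQ*)⁻¹(U^u)R(u) = R(u)(QGQ*)⁻¹(U)`, for any covariant `G`. [cite: Balaban1985BackgroundPropagators, (3.132) p.422, (3.34) p.396] -/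
theorem QGQinvOfY_cov {G : BondOpY 𝔸 i} (hB : IsGaugeLawB i parB) (hG : IsCovBondOpY i G) :
    Intw (conjY (gIBondY i g)) (conjY (gIBondY i g)) (QGQinvOfY i parB G U) (QGQinvOfY i parB G (gaugeY i g U)) :=
  (QGQOfY_cov hB hG).ringInverse (isUnit_conjY _)

/-- ★ `H(U^u)R(u) = R(u)H(U)` for `H = GQ*(QGQ*)⁻¹`, any covariant `G` (cf. [4] (2.35): `H` intertwines the gauge actions on the two lattices).
[cite: Balaban1985BackgroundPropagators, (3.126) p.421, (3.34) p.396] -/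
theorem HOfY_cov {G : BondOpY 𝔸 i} (hB : IsGaugeLawB i parB) (hG : IsCovBondOpY i G) :
    Intw (conjY (gIBondY i g)) (conjY (gBondY i g)) (HOfY i parB G U) (HOfY i parB G (gaugeY i g U)) :=
  (hG g U).comp ((QsY_cov g U hB).comp (QGQinvOfY_cov hB hG))

/-- n06-i's `QGQY` is covariant. [cite: Balaban1985BackgroundPropagators, (3.123) p.420, (3.34) p.396] -/
theorem QGQY_cov (hS : IsGaugeLawS i parS) (hB : IsGaugeLawB i parB) (hGp : IsCovSiteOpY i Gp) :
    Intw (conjY (gIBondY i g)) (conjY (gIBondY i g)) (QGQY i parS parB Gp U) (QGQY i parS parB Gp (gaugeY i g U)) :=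
  QGQOfY_cov hB (GDY_isCovBondOpY hS hB hGp)

/-- ★ n06-i's `(QGQ*)⁻¹` letter is covariant. [cite: Balaban1985BackgroundPropagators, (3.132) p.422, (3.34) p.396] -/
theorem QGQinvY_cov (hS : IsGaugeLawS i parS) (hB : IsGaugeLawB i parB) (hGp : IsCovSiteOpY i Gp) :
    Intw (conjY (gIBondY i g)) (conjY (gIBondY i g)) (QGQinvY i parS parB Gp U) (QGQinvY i parS parB Gp (gaugeY i g U)) :=
  QGQinvOfY_cov hB (GDY_isCovBondOpY hS hB hGp)

/-- ★ n06-i's `H` letter (3.126) is covariant. [cite: Balaban1985BackgroundPropagators, (3.126) p.421, (3.34) p.396] -/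
theorem HDY_cov (hS : IsGaugeLawS i parS) (hB : IsGaugeLawB i parB) (hGp : IsCovSiteOpY i Gp) :
    Intw (conjY (gIBondY i g)) (conjY (gBondY i g)) (HDY i parS parB Gp U) (HDY i parS parB Gp (gaugeY i g U)) :=
  HOfY_cov hB (GDY_isCovBondOpY hS hB hGp)

/-- `Δ⁽²⁾_π = π†Δ⁽²⁾π` (3.135) is covariant for a covariant residual letter. [cite: Balaban1985BackgroundPropagators, (3.135) p.422, (3.34) p.396] -/
theorem delta2PiY_cov {Δ2 : BondOpY 𝔸 i} (hS : IsGaugeLawS i parS) (hGp : IsCovSiteOpY i Gp) (hΔ : IsCovBondOpY i Δ2) :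
    Intw (conjY (gBondY i g)) (conjY (gBondY i g)) (delta2PiY i parS Gp Δ2 U) (delta2PiY i parS Gp Δ2 (gaugeY i g U)) :=
  (gaugePiTY_cov hS hGp).comp ((hΔ g U).comp (gaugePiY_cov hS hGp))

/-- `G₁⁻¹` (3.128) is covariant. [cite: Balaban1985BackgroundPropagators, (3.128) p.421, (3.34) p.396] -/
theorem deltaOneY_cov {Δ2 : BondOpY 𝔸 i} (hS : IsGaugeLawS i parS) (hB : IsGaugeLawB i parB) (hGp : IsCovSiteOpY i Gp) (hΔ : IsCovBondOpY i Δ2) :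
    Intw (conjY (gBondY i g)) (conjY (gBondY i g)) (deltaOneY i parS parB Gp Δ2 U) (deltaOneY i parS parB Gp Δ2 (gaugeY i g U)) :=
  (deltaPiAY_cov hS hB hGp).sub (delta2PiY_cov hS hGp hΔ)

/-- ★★ **`G₁(U^u)R(u) = R(u)G₁(U)`** (3.129). [cite: Balaban1985BackgroundPropagators, (3.128)–(3.129) p.421, (3.34) p.396] -/
theorem G1Y_cov {Δ2 : BondOpY 𝔸 i} (hS : IsGaugeLawS i parS) (hB : IsGaugeLawB i parB) (hGp : IsCovSiteOpY i Gp) (hΔ : IsCovBondOpY i Δ2) :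
    Intw (conjY (gBondY i g)) (conjY (gBondY i g)) (G1Y i parS parB Gp Δ2 U) (G1Y i parS parB Gp Δ2 (gaugeY i g U)) :=
  (deltaOneY_cov hS hB hGp hΔ).ringInverse (isUnit_conjY _)

/-- `G₁` is a covariant bond-sector letter. [cite: Balaban1985BackgroundPropagators, (3.129) p.421, (3.34) p.396] -/
theorem G1Y_isCovBondOpY {Δ2 : BondOpY 𝔸 i} (hS : IsGaugeLawS i parS) (hB : IsGaugeLawB i parB) (hGp : IsCovSiteOpY i Gp)
    (hΔ : IsCovBondOpY i Δ2) : IsCovBondOpY i (G1Y i parS parB Gp Δ2) := fun _ _ => G1Y_cov hS hB hGp hΔ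

/-- ★ `(QG₁Q*)⁻¹` (3.132) is covariant. [cite: Balaban1985BackgroundPropagators, (3.132) p.422, (3.34) p.396] -/
theorem QG1QinvY_cov {Δ2 : BondOpY 𝔸 i} (hS : IsGaugeLawS i parS) (hB : IsGaugeLawB i parB) (hGp : IsCovSiteOpY i Gp) (hΔ : IsCovBondOpY i Δ2) :
    Intw (conjY (gIBondY i g)) (conjY (gIBondY i g)) (QG1QinvY i parS parB Gp Δ2 U) (QG1QinvY i parS parB Gp Δ2 (gaugeY i g U)) :=
  QGQinvOfY_cov hB (G1Y_isCovBondOpY hS hB hGp hΔ)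

/-- ★ `H₁ = G₁Q*(QG₁Q*)⁻¹` (3.129) is covariant. [cite: Balaban1985BackgroundPropagators, (3.129) p.421, (3.34) p.396] -/
theorem H1Y_cov {Δ2 : BondOpY 𝔸 i} (hS : IsGaugeLawS i parS) (hB : IsGaugeLawB i parB) (hGp : IsCovSiteOpY i Gp) (hΔ : IsCovBondOpY i Δ2) :
    Intw (conjY (gIBondY i g)) (conjY (gBondY i g)) (H1Y i parS parB Gp Δ2 U) (H1Y i parS parB Gp Δ2 (gaugeY i g U)) :=
  HOfY_cov hB (G1Y_isCovBondOpY hS hB hGp hΔ)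

/-- `𝔓` (3.147) is covariant. [cite: Balaban1985BackgroundPropagators, (3.147) p.425, (3.34) p.396] -/
theorem frakPY_cov {Δ2 : BondOpY 𝔸 i} (hS : IsGaugeLawS i parS) (hB : IsGaugeLawB i parB) (hGp : IsCovSiteOpY i Gp) (hΔ : IsCovBondOpY i Δ2) :
    Intw (conjY (gBondY i g)) (conjY (gBondY i g)) (frakPY i parS parB Gp Δ2 U) (frakPY i parS parB Gp Δ2 (gaugeY i g U)) :=
  (Intw.id.sub ((G1Y_cov hS hB hGp hΔ).comp ((QsY_cov g U hB).comp ((QG1QinvY_cov hS hB hGp hΔ).comp (QY_cov g U hB))))).sub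
    ((G1Y_cov hS hB hGp hΔ).comp ((gradY_cov i g U).comp ((RY_cov hS hGp).comp (divY_cov i g U))))

/-- ★ `𝔊 = 𝔓G₁` (3.153) is covariant. [cite: Balaban1985BackgroundPropagators, (3.153) p.426, (3.34) p.396] -/
theorem GGY_cov {Δ2 : BondOpY 𝔸 i} (hS : IsGaugeLawS i parS) (hB : IsGaugeLawB i parB) (hGp : IsCovSiteOpY i Gp) (hΔ : IsCovBondOpY i Δ2) :
    Intw (conjY (gBondY i g)) (conjY (gBondY i g)) (GGY i parS parB Gp Δ2 U) (GGY i parS parB Gp Δ2 (gaugeY i g U)) :=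
  (frakPY_cov hS hB hGp hΔ).comp (G1Y_cov hS hB hGp hΔ)

/-- the site-sector `P = I − R` (3.49) is covariant ((3.33) for `R`). [cite: Balaban1985BackgroundPropagators, (3.49) p.399, (3.33) p.396] -/
theorem P349Y_cov (hS : IsGaugeLawS i parS) (hGp : IsCovSiteOpY i Gp) :
    Intw (conjY (gSiteY i g)) (conjY (gSiteY i g)) (P349Y i parS Gp U) (P349Y i parS Gp (gaugeY i g U)) :=
  Intw.id.sub (RY_cov hS hGp)

end SectDCov

/-! ## §G′ Theorem 3.14's letter and the v3 letters OF RECORD are gauge covariant -/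

section RecordCov

variable (𝔸) in
/-- v2's `G = Δ_a⁻¹` at an index is a covariant letter. [cite: Balaban1985BackgroundPropagators, (3.34) p.396] -/
theorem GAv2Y_isCovBondOpY (i : KIdx d ℓ hd hL b₀ b₁) : IsCovBondOpY i (GAv2Y 𝔸 i) :=
  GAY_isCovBondOpY (parSY_isGaugeLawS i) (parBY_isGaugeLawB i) (GpY_isCovSiteOpY (parSY_isGaugeLawS i))

variable {x : MemberY d ℓ hd hL b₀ b₁ Mstar} (g : GaugeY 𝔸 x.toKIdx) (U : CfgY 𝔸 x.toKIdx)

variable (𝔸 x) in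
/-- `G(Ω′, ·)` (the second-sequence operator) is covariant under the SAME gauge functions (same torus). [cite: Balaban1985BackgroundPropagators, Thm 3.14 pp.426–427, (3.34) p.396] -/
theorem GAsndY_isCovBondOpY : IsCovBondOpY x.toKIdx (GAsndY 𝔸 x) := fun g U => GAv2Y_isCovBondOpY 𝔸 x.snd g U

/-- ★★ **THEOREM 3.14's LETTER IS COVARIANT**: `(G(Ω, U^u) − G(Ω′, U^u))R(u) = R(u)(G(Ω, U) − G(Ω′, U))`.
[cite: Balaban1985BackgroundPropagators, Thm 3.14 pp.426–427, (3.34) p.396] -/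
theorem KdiffY_cov : Intw (conjY (gBondY x.toKIdx g)) (conjY (gBondY x.toKIdx g)) (KdiffY 𝔸 x U) (KdiffY 𝔸 x (gaugeY x.toKIdx g U)) :=
  (GAv2Y_isCovBondOpY 𝔸 x.toKIdx g U).sub (GAsndY_isCovBondOpY 𝔸 x g U)

/-- ★★★ **THE v3 LETTERS ARE GAUGE COVARIANT** for a covariant residual `Δ⁽²⁾`: `GD, G₁, GG, Kdiff` under `R(u)` on bonds; `H, H₁` from coarse bonds to
bonds; `QGQinv, QG1Qinv` on coarse bonds (the Sect. B letters `GA, C, Gp` by `lettersYOfRecord_cov`). [cite: Balaban1985BackgroundPropagators, (3.33)–(3.34) p.396, (3.119)–(3.153) pp.419–426] -/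
theorem covLettersY_v3_cov (𝔯 : ResLettersY 𝔸 x) (hΔ : IsCovBondOpY x.toKIdx 𝔯.Δ2) :
    Intw (conjY (gBondY x.toKIdx g)) (conjY (gBondY x.toKIdx g)) ((covLettersY_v3 𝔸 x 𝔯).GD U) ((covLettersY_v3 𝔸 x 𝔯).GD (gaugeY x.toKIdx g U)) ∧
      Intw (conjY (gBondY x.toKIdx g)) (conjY (gBondY x.toKIdx g)) ((covLettersY_v3 𝔸 x 𝔯).G₁ U) ((covLettersY_v3 𝔸 x 𝔯).G₁ (gaugeY x.toKIdx g U)) ∧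
      Intw (conjY (gBondY x.toKIdx g)) (conjY (gBondY x.toKIdx g)) ((covLettersY_v3 𝔸 x 𝔯).GG U) ((covLettersY_v3 𝔸 x 𝔯).GG (gaugeY x.toKIdx g U)) ∧
      Intw (conjY (gBondY x.toKIdx g)) (conjY (gBondY x.toKIdx g)) ((covLettersY_v3 𝔸 x 𝔯).Kdiff U) ((covLettersY_v3 𝔸 x 𝔯).Kdiff (gaugeY x.toKIdx g U)) ∧
      Intw (conjY (gIBondY x.toKIdx g)) (conjY (gBondY x.toKIdx g)) ((covLettersY_v3 𝔸 x 𝔯).H U) ((covLettersY_v3 𝔸 x 𝔯).H (gaugeY x.toKIdx g U)) ∧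
      Intw (conjY (gIBondY x.toKIdx g)) (conjY (gBondY x.toKIdx g)) ((covLettersY_v3 𝔸 x 𝔯).H₁ U) ((covLettersY_v3 𝔸 x 𝔯).H₁ (gaugeY x.toKIdx g U)) ∧
      Intw (conjY (gIBondY x.toKIdx g)) (conjY (gIBondY x.toKIdx g)) ((covLettersY_v3 𝔸 x 𝔯).QGQinv U)
        ((covLettersY_v3 𝔸 x 𝔯).QGQinv (gaugeY x.toKIdx g U)) ∧
      Intw (conjY (gIBondY x.toKIdx g)) (conjY (gIBondY x.toKIdx g)) ((covLettersY_v3 𝔸 x 𝔯).QG1Qinv U)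
        ((covLettersY_v3 𝔸 x 𝔯).QG1Qinv (gaugeY x.toKIdx g U)) :=
  have hS := parSY_isGaugeLawS (𝔸 := 𝔸) x.toKIdx
  have hB := parBY_isGaugeLawB (𝔸 := 𝔸) x.toKIdx
  have hGp := GpY_isCovSiteOpY hS
  ⟨GDY_cov hS hB hGp, G1Y_cov hS hB hGp hΔ, GGY_cov hS hB hGp hΔ, KdiffY_cov g U, HDY_cov hS hB hGp, H1Y_cov hS hB hGp hΔ,
    QGQinvY_cov hS hB hGp, QG1QinvY_cov hS hB hGp hΔ⟩

open scoped Matrix.Norms.L2Operator in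
/-- ★★★ **THE v3 LETTERS OF RECORD ARE GAUGE COVARIANT** at every member, for a covariant residual family.
[cite: Balaban1985BackgroundPropagators, (3.33)–(3.34) p.396, (3.119)–(3.153) pp.419–426, Thm 3.14 pp.426–427] -/
theorem lettersYOfRecordDE_cov (N : ℕ) (θ : Stage3Params) (Mstar : ℕ) (𝔯 : ResY N θ Mstar) (x : MemberY θ.d₆ θ.ℓ₆ θ.hd' θ.hL' θ.b₀ θ.b₁ Mstar)
    (hΔ : IsCovBondOpY x.toKIdx (𝔯 x).Δ2) (g : GaugeY (Matrix (Fin N) (Fin N) ℂ) x.toKIdx) (U : CfgY (Matrix (Fin N) (Fin N) ℂ) x.toKIdx) :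
    Intw (conjY (gBondY x.toKIdx g)) (conjY (gBondY x.toKIdx g)) ((lettersYOfRecordDE N θ Mstar 𝔯 x).GD U)
        ((lettersYOfRecordDE N θ Mstar 𝔯 x).GD (gaugeY x.toKIdx g U)) ∧
      Intw (conjY (gBondY x.toKIdx g)) (conjY (gBondY x.toKIdx g)) ((lettersYOfRecordDE N θ Mstar 𝔯 x).G₁ U)
        ((lettersYOfRecordDE N θ Mstar 𝔯 x).G₁ (gaugeY x.toKIdx g U)) ∧
      Intw (conjY (gBondY x.toKIdx g)) (conjY (gBondY x.toKIdx g)) ((lettersYOfRecordDE N θ Mstar 𝔯 x).GG U)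
        ((lettersYOfRecordDE N θ Mstar 𝔯 x).GG (gaugeY x.toKIdx g U)) ∧
      Intw (conjY (gBondY x.toKIdx g)) (conjY (gBondY x.toKIdx g)) ((lettersYOfRecordDE N θ Mstar 𝔯 x).Kdiff U)
        ((lettersYOfRecordDE N θ Mstar 𝔯 x).Kdiff (gaugeY x.toKIdx g U)) ∧
      Intw (conjY (gIBondY x.toKIdx g)) (conjY (gBondY x.toKIdx g)) ((lettersYOfRecordDE N θ Mstar 𝔯 x).H U)
        ((lettersYOfRecordDE N θ Mstar 𝔯 x).H (gaugeY x.toKIdx g U)) ∧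
      Intw (conjY (gIBondY x.toKIdx g)) (conjY (gBondY x.toKIdx g)) ((lettersYOfRecordDE N θ Mstar 𝔯 x).H₁ U)
        ((lettersYOfRecordDE N θ Mstar 𝔯 x).H₁ (gaugeY x.toKIdx g U)) ∧
      Intw (conjY (gIBondY x.toKIdx g)) (conjY (gIBondY x.toKIdx g)) ((lettersYOfRecordDE N θ Mstar 𝔯 x).QGQinv U)
        ((lettersYOfRecordDE N θ Mstar 𝔯 x).QGQinv (gaugeY x.toKIdx g U)) ∧
      Intw (conjY (gIBondY x.toKIdx g)) (conjY (gIBondY x.toKIdx g)) ((lettersYOfRecordDE N θ Mstar 𝔯 x).QG1Qinv U)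
        ((lettersYOfRecordDE N θ Mstar 𝔯 x).QG1Qinv (gaugeY x.toKIdx g U)) :=
  covLettersY_v3_cov g U (𝔯 x) hΔ

end RecordCov

end

end Literature.MathematicalPhysics.QuantumFieldTheory.Balaban1983to89.Node00
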